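import Literature.Probability.RandomPlanarGeometry.HexSAWBrickWallStripWidthOneSeries
import Literature.Probability.RandomPlanarGeometry.HexSAWBrickWallStripFugacitySymmetric
import Mathlib.RingTheory.PowerSeries.Inverse
import Mathlib.Tactic
import HarnessLib

/-!
# The two-fugacity walk series of the one-cell honeycomb strip is rational:
# `Σ_N C_{1,N}(y,z) x^N = P(x; y, z) / ( [(1 − yx²)(1 − zx²) − yzx⁶] · (1 − yzx⁴)² )`

Topic `Literature/Probability/RandomPlanarGeometry` (continues `HexSAWBrickWallStripWidthOneSeries.lean`: the counting
automaton of the one-cell strip `S_1 = ℤ × {0,1}` of the brick wall, `WidthOne.δ`, `WidthOne.run`, `WidthOne.acc`, and the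
theorem `WidthOne.good_iff_isSome` that it accepts exactly the step words of the self-avoiding walks of `S_1`; and
`HexSAWBrickWallStripFugacitySymmetric.lean`: the printed two-fugacity partition function `HexBW.stripZ₂ T N y z = C_{T,N}(y,z)`
of Beaton–Bousquet-Mélou–de Gier–Duminil-Copin–Guttmann, §3.2 — weight `y` per bottom-surface vertex (bottom row, odd column),
`z` per top-surface vertex (top row, odd column), over the walks of `S_T` up to its translations).

Source of the objects: N. R. Beaton, M. Bousquet-Mélou, J. de Gier, H. Duminil-Copin, A. J. Guttmann, *The critical fugacity
for surface adsorption of self-avoiding walks on the honeycomb lattice is `1+√2`*, Comm. Math. Phys. 326 (2014),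
arXiv:1109.0358v5, §3.2 and Proposition 6 (the strips `S_T`, `C_{T,k}(y,z) = Σ_{|ω|=k} y^{bc(ω)} z^{tc(ω)}`, the rate
`μ_T(y,z)`); p. 12: "all series counting walks in a strip that occur in this section [are] rational" (via the transfer-matrix
method and [1] = Alm–Janson 1990) — no closed form is printed.  Method: R. P. Stanley, *Enumerative Combinatorics* vol. 1
(2nd ed.), §4.7 (transfer-matrix method, Theorem 4.7.2), §4.1 (Theorem 4.1.1).  THIS FILE gives the closed form at `T = 1`:

  ★★★ `stripZ₂_one_series : (Σ_N C_{1,N}(y,z) X^N) · [(1 − yX²)(1 − zX²) − yzX⁶] · (1 − yzX⁴)² = twoWallP y z`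

for all real `y, z`, with the explicit polynomial `twoWallP` (x-degree 15, symmetric in `y ↔ z`; at `y = z = 1` the identity
reduces to `HexSAWBrickWallStripWidthOneSeries.stripCount_one_series` after multiplying by `(1 − x²)²/((1 − x²)²)` … i.e.
`[(1−x²)² − x⁶](1−x⁴)² = (1−x²−x³)(1−x²+x³)(1−x⁴)²`).  The dominant singularity is the smallest positive root of the
sextic factor: `x⁻² = s` with `s(s−y)(s−z) = yz`, `s = μ_1(y,z)²` — the law proved by other means in
`HexSAWBrickWallStripFugacityWidthOneExact.lean` (`y = z`), `…WidthOneSextic.lean` and `…WidthOneSexticLower.lean`.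

## Method

§1 The WEIGHTED automaton `W₂ y z p s ρ m` on structural-parity states `S2` (the states of the unweighted automaton with the
parities of their run-length parameters made explicit, so that the column parity — hence the weight `1`, `y` or `z` — of every
successor site is hard-wired; the corridor states carry the current column parity `c`; `ρ` = current row; `p` = parity of the
starting column), `stepR`/`stepP`, `W₂_succ`, `coeff_stepP`.  §2 `D₂ = (1−yX²)(1−zX²)·qE·qC²` and its inverse `uD`, the
numerators `pol…` (found by machine from the series and written in factored form `core × qY/qE/qC`), `Ψ p s ρ := pol · D₂⁻¹`
with `y ↔ z` on the top row.  §3 the one-step identities `Ψ_<state>` — each `cases p <;> cases ρ <;> simp only [defs] <;>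
linear_combination huD`, i.e. a polynomial identity in `X, C y, C z` with symbolic exponents — and `Ψ_eq`.  §4 `coeff_Ψ_eq_W₂`
(induction on `m`), `mk_W₂_eq_Ψ`.  §5 `twoWallZ`, `twoWallP`, ★★ `twoWallZ_series`.  §6 THE GLUE with the geometry of the
unweighted file: `par`, `swt` (site weight), `wprod` (weight of a placed word), `enc` (structural state of a geometric state at a
column), `CPar`/`Compat` (the column parity the weighted automaton assumes is the actual one), `GlueConcl` and the nine
`glue_<state>` lemmas (one letter: successors stay compatible and the letter sum of `weight × W₂(successor)` is `stepR` at the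
encoded state), `glue_all`, `compat_step`, `accZ` (weighted sum over accepted words), `accZ_succ`, ★★ `accZ_eq`
(`accZ = W₂ ∘ enc` from every compatible state), `pow_ind_eq_swt`, `pow_visits_eq_prod` and `prod_swt_traj` (the printed weight
`y^{bottomVisits₀} z^{topVisits₀}` of a placed word is `swt(start) · wprod`), `sum_filter_stripPairs`, ★★★
`stripZ₂_one_eq_twoWallZ : stripZ₂ 1 N y z = twoWallZ y z N`, ★★★ `stripZ₂_one_series`, and the specialisations ★★ `stripZ₀_one_series`
(`z = 1`, one attracting wall) and ★★ `stripZ₂_one_self_series` (`z = y`, denominator `(1 − yX² − yX³)(1 − yX² + yX³)(1 − y²X⁴)²`).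

All statements: namespace `Literature.Probability.RandomPlanarGeometry.SAW.HexBW.WidthOneYZ`, PROVED, standard axioms.
NOT here: widths `T ≥ 2`; the identification of the pole with `HexBW.stripMuY₂ 1 y z` (the radius statement is the tree's
sextic law; a Pringsheim-type argument on this explicit rational function would re-derive it and is left to the reader/sequel).
-/

noncomputable section

open Finset PowerSeries Literature.Probability.LatticeModels Literature.Probability.Percolation SimpleGraph

namespace Literature.Probability.RandomPlanarGeometry.SAW.HexBW

namespace WidthOneYZ

/-- The states of the weighted counting automaton of `S_1`, with run-length parities made structural (`…E i` = even
parameter `2i`, `…O i` = odd parameter `2i+1` of the states of `HexSAWBrickWallStripWidthOneSeries.lean`; `rg1Z` = `rg1 0`,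
`rg1O i` = `rg1 (2i+1)`, `rg1E i` = `rg1 (2i+2)`; the corridor states carry the parity `c` of the current column, `true` = odd).
[cite: Stanley2012EC1, §4.7 (transfer-matrix method)] -/
inductive S2
  | start
  | iniE (i : ℕ) | iniO (i : ℕ)
  | rg1Z | rg1O (i : ℕ) | rg1E (i : ℕ)
  | utE (i : ℕ) | utO (i : ℕ)
  | upE (i : ℕ) | upO (i : ℕ)
  | fwdE (i : ℕ) | fwdO (i : ℕ)
  | rg2E (i : ℕ) | rg2O (i : ℕ)
  | corE (i : ℕ) (c : Bool) | corO (i : ℕ) (c : Bool)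
  deriving DecidableEq, Repr

open S2

section automaton

variable (y z : ℝ)

/-- The weight of an odd-column site on row `ρ` (`y` on the bottom row `ρ = false`, `z` on the top row). Even-column sites weigh `1`.
[cite: BeatonBousquetMelouDeGierDuminilCopinGuttmann2014, §3.2 (arXiv v5 p. 10: C_{T,k}(y,z) = Σ y^{bc(ω)} z^{tc(ω)})] -/
def wρ (ρ : Bool) : ℝ := bif ρ then z else y

/-- **The weighted counts `W₂ p s ρ m`**: total weight (product of the site weights) of the accepted continuations of length `m`
from state `s` on row `ρ`, start-column parity `p` (`false` = even); the weight of the current site is not included. Rungs flip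
the row; the column parity of every successor site is determined by `p` and the state (hard-wired below).
[cite: Stanley2012EC1, §4.7 (transfer-matrix method)] -/
def W₂ : Bool → S2 → Bool → ℕ → ℝ
  | _, _, _, 0 => 1
  | false, start, ρ, m + 1 => wρ y z ρ * W₂ false (iniE 0) ρ m + wρ y z ρ * W₂ false (iniE 0) ρ m + W₂ false rg1Z (!ρ) m
  | false, (iniE i), ρ, m + 1 => W₂ false (iniO i) ρ m
  | false, (iniO i), ρ, m + 1 => wρ y z ρ * W₂ false (iniE (i + 1)) ρ m + W₂ false (rg1E i) (!ρ) m
  | false, rg1Z, ρ, m + 1 => wρ y z ρ * W₂ false (fwdE 0) ρ m + wρ y z ρ * W₂ false (fwdE 0) ρ m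
  | false, (rg1O i), ρ, m + 1 => wρ y z ρ * W₂ false (fwdE 0) ρ m + W₂ false (utE i) ρ m
  | false, (rg1E i), ρ, m + 1 => wρ y z ρ * W₂ false (fwdE 0) ρ m + wρ y z ρ * W₂ false (utO i) ρ m
  | false, (utE 0), ρ, m + 1 => wρ y z ρ * W₂ false (upE 0) ρ m
  | false, (utE (n + 1)), ρ, m + 1 => wρ y z ρ * W₂ false (utO n) ρ m
  | false, (utO i), ρ, m + 1 => W₂ false (utE i) ρ m
  | false, (upE i), ρ, m + 1 => W₂ false (upO i) ρ m
  | false, (upO i), ρ, m + 1 => W₂ false (rg2O i) (!ρ) m + wρ y z ρ * W₂ false (upE (i + 1)) ρ m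
  | false, (fwdE i), ρ, m + 1 => W₂ false (fwdO i) ρ m
  | false, (fwdO i), ρ, m + 1 => wρ y z ρ * W₂ false (fwdE (i + 1)) ρ m + W₂ false (rg2O i) (!ρ) m
  | false, (rg2E 0), ρ, m + 1 => wρ y z ρ * W₂ false (fwdE 0) ρ m
  | false, (rg2E (n + 1)), ρ, m + 1 => wρ y z ρ * W₂ false (corO n true) ρ m + wρ y z ρ * W₂ false (fwdE 0) ρ m
  | false, (rg2O i), ρ, m + 1 => wρ y z ρ * W₂ false (corE i true) ρ m + wρ y z ρ * W₂ false (fwdE 0) ρ m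
  | false, (corE 0 false), _, _ + 1 => 0
  | false, (corE (n + 1) false), ρ, m + 1 => wρ y z ρ * W₂ false (corO n true) ρ m
  | false, (corE 0 true), _, _ + 1 => 0
  | false, (corE (n + 1) true), ρ, m + 1 => W₂ false (corO n false) ρ m
  | false, (corO i false), ρ, m + 1 => wρ y z ρ * W₂ false (corE i true) ρ m
  | false, (corO i true), ρ, m + 1 => W₂ false (corE i false) ρ m
  | true, start, ρ, m + 1 => W₂ true (iniE 0) ρ m + W₂ true (iniE 0) ρ m
  | true, (iniE i), ρ, m + 1 => wρ y z ρ * W₂ true (iniO i) ρ m + W₂ true (rg1O i) (!ρ) m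
  | true, (iniO i), ρ, m + 1 => W₂ true (iniE (i + 1)) ρ m
  | true, rg1Z, ρ, m + 1 => wρ y z ρ * W₂ true (fwdE 0) ρ m + wρ y z ρ * W₂ true (fwdE 0) ρ m
  | true, (rg1O i), ρ, m + 1 => wρ y z ρ * W₂ true (fwdE 0) ρ m + wρ y z ρ * W₂ true (utE i) ρ m
  | true, (rg1E i), ρ, m + 1 => wρ y z ρ * W₂ true (fwdE 0) ρ m + W₂ true (utO i) ρ m
  | true, (utE 0), ρ, m + 1 => W₂ true (upE 0) ρ m
  | true, (utE (n + 1)), ρ, m + 1 => W₂ true (utO n) ρ m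
  | true, (utO i), ρ, m + 1 => wρ y z ρ * W₂ true (utE i) ρ m
  | true, (upE i), ρ, m + 1 => W₂ true (rg2E i) (!ρ) m + wρ y z ρ * W₂ true (upO i) ρ m
  | true, (upO i), ρ, m + 1 => W₂ true (upE (i + 1)) ρ m
  | true, (fwdE i), ρ, m + 1 => W₂ true (fwdO i) ρ m
  | true, (fwdO i), ρ, m + 1 => wρ y z ρ * W₂ true (fwdE (i + 1)) ρ m + W₂ true (rg2O i) (!ρ) m
  | true, (rg2E 0), ρ, m + 1 => wρ y z ρ * W₂ true (fwdE 0) ρ m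
  | true, (rg2E (n + 1)), ρ, m + 1 => wρ y z ρ * W₂ true (corO n true) ρ m + wρ y z ρ * W₂ true (fwdE 0) ρ m
  | true, (rg2O i), ρ, m + 1 => wρ y z ρ * W₂ true (corE i true) ρ m + wρ y z ρ * W₂ true (fwdE 0) ρ m
  | true, (corE 0 false), _, _ + 1 => 0
  | true, (corE (n + 1) false), ρ, m + 1 => wρ y z ρ * W₂ true (corO n true) ρ m
  | true, (corE 0 true), _, _ + 1 => 0
  | true, (corE (n + 1) true), ρ, m + 1 => W₂ true (corO n false) ρ m
  | true, (corO i false), ρ, m + 1 => wρ y z ρ * W₂ true (corE i true) ρ m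
  | true, (corO i true), ρ, m + 1 => W₂ true (corE i false) ρ m

/-- One transition as a weighted sum over the successors (real version of the right-hand sides of `W₂`).
[cite: Stanley2012EC1, §4.7 (transfer-matrix method)] -/
def stepR (p : Bool) (f : S2 → Bool → ℝ) (s : S2) (ρ : Bool) : ℝ :=
  match p, s with
  | false, start => wρ y z ρ * f (iniE 0) ρ + wρ y z ρ * f (iniE 0) ρ + f rg1Z (!ρ)
  | false, (iniE i) => f (iniO i) ρ
  | false, (iniO i) => wρ y z ρ * f (iniE (i + 1)) ρ + f (rg1E i) (!ρ)
  | false, rg1Z => wρ y z ρ * f (fwdE 0) ρ + wρ y z ρ * f (fwdE 0) ρ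
  | false, (rg1O i) => wρ y z ρ * f (fwdE 0) ρ + f (utE i) ρ
  | false, (rg1E i) => wρ y z ρ * f (fwdE 0) ρ + wρ y z ρ * f (utO i) ρ
  | false, (utE 0) => wρ y z ρ * f (upE 0) ρ
  | false, (utE (n + 1)) => wρ y z ρ * f (utO n) ρ
  | false, (utO i) => f (utE i) ρ
  | false, (upE i) => f (upO i) ρ
  | false, (upO i) => f (rg2O i) (!ρ) + wρ y z ρ * f (upE (i + 1)) ρ
  | false, (fwdE i) => f (fwdO i) ρ
  | false, (fwdO i) => wρ y z ρ * f (fwdE (i + 1)) ρ + f (rg2O i) (!ρ)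
  | false, (rg2E 0) => wρ y z ρ * f (fwdE 0) ρ
  | false, (rg2E (n + 1)) => wρ y z ρ * f (corO n true) ρ + wρ y z ρ * f (fwdE 0) ρ
  | false, (rg2O i) => wρ y z ρ * f (corE i true) ρ + wρ y z ρ * f (fwdE 0) ρ
  | false, (corE 0 false) => 0
  | false, (corE (n + 1) false) => wρ y z ρ * f (corO n true) ρ
  | false, (corE 0 true) => 0
  | false, (corE (n + 1) true) => f (corO n false) ρ
  | false, (corO i false) => wρ y z ρ * f (corE i true) ρ
  | false, (corO i true) => f (corE i false) ρ
  | true, start => f (iniE 0) ρ + f (iniE 0) ρ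
  | true, (iniE i) => wρ y z ρ * f (iniO i) ρ + f (rg1O i) (!ρ)
  | true, (iniO i) => f (iniE (i + 1)) ρ
  | true, rg1Z => wρ y z ρ * f (fwdE 0) ρ + wρ y z ρ * f (fwdE 0) ρ
  | true, (rg1O i) => wρ y z ρ * f (fwdE 0) ρ + wρ y z ρ * f (utE i) ρ
  | true, (rg1E i) => wρ y z ρ * f (fwdE 0) ρ + f (utO i) ρ
  | true, (utE 0) => f (upE 0) ρ
  | true, (utE (n + 1)) => f (utO n) ρ
  | true, (utO i) => wρ y z ρ * f (utE i) ρ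
  | true, (upE i) => f (rg2E i) (!ρ) + wρ y z ρ * f (upO i) ρ
  | true, (upO i) => f (upE (i + 1)) ρ
  | true, (fwdE i) => f (fwdO i) ρ
  | true, (fwdO i) => wρ y z ρ * f (fwdE (i + 1)) ρ + f (rg2O i) (!ρ)
  | true, (rg2E 0) => wρ y z ρ * f (fwdE 0) ρ
  | true, (rg2E (n + 1)) => wρ y z ρ * f (corO n true) ρ + wρ y z ρ * f (fwdE 0) ρ
  | true, (rg2O i) => wρ y z ρ * f (corE i true) ρ + wρ y z ρ * f (fwdE 0) ρ
  | true, (corE 0 false) => 0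
  | true, (corE (n + 1) false) => wρ y z ρ * f (corO n true) ρ
  | true, (corE 0 true) => 0
  | true, (corE (n + 1) true) => f (corO n false) ρ
  | true, (corO i false) => wρ y z ρ * f (corE i true) ρ
  | true, (corO i true) => f (corE i false) ρ

/-- One transition as a weighted sum over the successors (power-series version of the right-hand sides of `W₂`).
[cite: Stanley2012EC1, §4.7 (transfer-matrix method)] -/
def stepP (p : Bool) (f : S2 → Bool → ℝ⟦X⟧) (s : S2) (ρ : Bool) : ℝ⟦X⟧ :=
  match p, s with
  | false, start => C (wρ y z ρ) * f (iniE 0) ρ + C (wρ y z ρ) * f (iniE 0) ρ + f rg1Z (!ρ)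
  | false, (iniE i) => f (iniO i) ρ
  | false, (iniO i) => C (wρ y z ρ) * f (iniE (i + 1)) ρ + f (rg1E i) (!ρ)
  | false, rg1Z => C (wρ y z ρ) * f (fwdE 0) ρ + C (wρ y z ρ) * f (fwdE 0) ρ
  | false, (rg1O i) => C (wρ y z ρ) * f (fwdE 0) ρ + f (utE i) ρ
  | false, (rg1E i) => C (wρ y z ρ) * f (fwdE 0) ρ + C (wρ y z ρ) * f (utO i) ρ
  | false, (utE 0) => C (wρ y z ρ) * f (upE 0) ρ
  | false, (utE (n + 1)) => C (wρ y z ρ) * f (utO n) ρ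
  | false, (utO i) => f (utE i) ρ
  | false, (upE i) => f (upO i) ρ
  | false, (upO i) => f (rg2O i) (!ρ) + C (wρ y z ρ) * f (upE (i + 1)) ρ
  | false, (fwdE i) => f (fwdO i) ρ
  | false, (fwdO i) => C (wρ y z ρ) * f (fwdE (i + 1)) ρ + f (rg2O i) (!ρ)
  | false, (rg2E 0) => C (wρ y z ρ) * f (fwdE 0) ρ
  | false, (rg2E (n + 1)) => C (wρ y z ρ) * f (corO n true) ρ + C (wρ y z ρ) * f (fwdE 0) ρ
  | false, (rg2O i) => C (wρ y z ρ) * f (corE i true) ρ + C (wρ y z ρ) * f (fwdE 0) ρ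
  | false, (corE 0 false) => 0
  | false, (corE (n + 1) false) => C (wρ y z ρ) * f (corO n true) ρ
  | false, (corE 0 true) => 0
  | false, (corE (n + 1) true) => f (corO n false) ρ
  | false, (corO i false) => C (wρ y z ρ) * f (corE i true) ρ
  | false, (corO i true) => f (corE i false) ρ
  | true, start => f (iniE 0) ρ + f (iniE 0) ρ
  | true, (iniE i) => C (wρ y z ρ) * f (iniO i) ρ + f (rg1O i) (!ρ)
  | true, (iniO i) => f (iniE (i + 1)) ρ
  | true, rg1Z => C (wρ y z ρ) * f (fwdE 0) ρ + C (wρ y z ρ) * f (fwdE 0) ρ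
  | true, (rg1O i) => C (wρ y z ρ) * f (fwdE 0) ρ + C (wρ y z ρ) * f (utE i) ρ
  | true, (rg1E i) => C (wρ y z ρ) * f (fwdE 0) ρ + f (utO i) ρ
  | true, (utE 0) => f (upE 0) ρ
  | true, (utE (n + 1)) => f (utO n) ρ
  | true, (utO i) => C (wρ y z ρ) * f (utE i) ρ
  | true, (upE i) => f (rg2E i) (!ρ) + C (wρ y z ρ) * f (upO i) ρ
  | true, (upO i) => f (upE (i + 1)) ρ
  | true, (fwdE i) => f (fwdO i) ρ
  | true, (fwdO i) => C (wρ y z ρ) * f (fwdE (i + 1)) ρ + f (rg2O i) (!ρ)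
  | true, (rg2E 0) => C (wρ y z ρ) * f (fwdE 0) ρ
  | true, (rg2E (n + 1)) => C (wρ y z ρ) * f (corO n true) ρ + C (wρ y z ρ) * f (fwdE 0) ρ
  | true, (rg2O i) => C (wρ y z ρ) * f (corE i true) ρ + C (wρ y z ρ) * f (fwdE 0) ρ
  | true, (corE 0 false) => 0
  | true, (corE (n + 1) false) => C (wρ y z ρ) * f (corO n true) ρ
  | true, (corE 0 true) => 0
  | true, (corE (n + 1) true) => f (corO n false) ρ
  | true, (corO i false) => C (wρ y z ρ) * f (corE i true) ρ
  | true, (corO i true) => f (corE i false) ρ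

/-- The recursion of `W₂` is `stepR`. [cite: Stanley2012EC1, §4.7] -/
theorem W₂_succ (p : Bool) (s : S2) (ρ : Bool) (m : ℕ) :
    W₂ y z p s ρ (m + 1) = stepR y z p (fun t ρ' => W₂ y z p t ρ' m) s ρ := by
  cases p <;> rcases s with _ | i | i | _ | i | i | (_ | n) | i | i | i | i | i | (_ | n) | i | ⟨_ | n, _ | _⟩ | ⟨i, _ | _⟩ <;> rfl

/-- `W₂ p s ρ 0 = 1`. [cite: Stanley2012EC1, §4.7] -/
@[simp] theorem W₂_zero (p : Bool) (s : S2) (ρ : Bool) : W₂ y z p s ρ 0 = 1 := by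
  cases p <;> rcases s with _ | i | i | _ | i | i | (_ | n) | i | i | i | i | i | (_ | n) | i | ⟨_ | n, _ | _⟩ | ⟨i, _ | _⟩ <;> rfl

/-- Coefficients commute with the transition sum. [cite: Stanley2012EC1, §4.7] -/
theorem coeff_stepP (p : Bool) (F : S2 → Bool → ℝ⟦X⟧) (s : S2) (ρ : Bool) (m : ℕ) :
    coeff m (stepP y z p F s ρ) = stepR y z p (fun t ρ' => coeff m (F t ρ')) s ρ := by
  cases p <;> rcases s with _ | i | i | _ | i | i | (_ | n) | i | i | i | i | i | (_ | n) | i | ⟨_ | n, _ | _⟩ | ⟨i, _ | _⟩ <;> simp [stepP, stepR, PowerSeries.coeff_C_mul]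

/-! ## §2 The closed forms

Every series `Σ_m W₂ p s ρ m X^m` is rational with denominator dividing
`D₂ = (1 − yX²)(1 − zX²)·[(1 − yX²)(1 − zX²) − yzX⁶]·(1 − yzX⁴)²`; the numerators below were found by machine (fit on the series,
then verified here once and for all by `linear_combination`).  They are written for the bottom row (`cy = C y`, `cz = C z`); the
top-row ones are the same with `y` and `z` exchanged. -/

/-- `1 − w X²`. [cite: Stanley2012EC1, §4.1 (Theorem 4.1.1)] -/
def qY (w : ℝ⟦X⟧) : ℝ⟦X⟧ := 1 - w * X ^ 2
/-- `(1 − yX²)(1 − zX²) − yzX⁶` (the sextic factor: its reciprocal root is `μ_1(y,z)²`). [cite: Stanley2012EC1, §4.1 (Theorem 4.1.1)] -/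
def qE (cy cz : ℝ⟦X⟧) : ℝ⟦X⟧ := (1 - cy * X ^ 2) * (1 - cz * X ^ 2) - cy * cz * X ^ 6
/-- `1 − yzX⁴` (the U-turn factor). [cite: Stanley2012EC1, §4.1 (Theorem 4.1.1)] -/
def qC (cy cz : ℝ⟦X⟧) : ℝ⟦X⟧ := 1 - cy * cz * X ^ 4
/-- The common denominator `D₂`. [cite: Stanley2012EC1, §4.1 (Theorem 4.1.1)] -/
def D₂ : ℝ⟦X⟧ := qY (C y) * qY (C z) * qE (C y) (C z) * qC (C y) (C z) ^ 2

/-- `D₂` has constant coefficient `1`. [cite: Stanley2012EC1, §4.1] -/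
theorem constantCoeff_D₂ : constantCoeff (D₂ y z) = 1 := by
  simp [D₂, qY, qE, qC]

/-- `D₂⁻¹`. [cite: Stanley2012EC1, §4.1 (Theorem 4.1.1)] -/
def uD : ℝ⟦X⟧ := PowerSeries.invOfUnit (D₂ y z) 1

/-- `D₂ · D₂⁻¹ = 1`, expanded. [cite: Stanley2012EC1, §4.1] -/
theorem huD : (1 - C y * X ^ 2) * (1 - C z * X ^ 2) * ((1 - C y * X ^ 2) * (1 - C z * X ^ 2) - C y * C z * X ^ 6) *
    (1 - C y * C z * X ^ 4) ^ 2 * uD y z = (1 : ℝ⟦X⟧) := by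
  have h := PowerSeries.mul_invOfUnit (D₂ y z) 1 (by rw [constantCoeff_D₂]; rfl)
  simp only [D₂, qY, qE, qC] at h; exact h

/-- Numerator for the states `start` (bottom row; machine-found, verified below). [cite: Stanley2012EC1, §4.7] -/
def polStart (cy cz : ℝ⟦X⟧) (p : Bool) : ℝ⟦X⟧ :=
  match p with
  | false => ((1) + (1 + 2 * cy) * X + (cz + cy) * X ^ 2 + (cz + cy - 2 * cy * cz) * X ^ 3 + (2 * cz - (cy * cz)) * X ^ 4 + (3 * cy * cz - 4 * cy ^ 2 * cz) * X ^ 5 + (cy * cz - 2 * cy * cz ^ 2 - 2 * cy ^ 2 * cz) * X ^ 6 + (cy * cz - 2 * cy * cz ^ 2 - 2 * cy ^ 2 * cz + 4 * cy ^ 2 * cz ^ 2) * X ^ 7 + (2 * cy * cz ^ 2 - (cy ^ 2 * cz ^ 2)) * X ^ 8 + (-3 * cy ^ 2 * cz ^ 2 + 2 * cy ^ 3 * cz ^ 2) * X ^ 9 + (-2 * cy ^ 2 * cz ^ 2 + cy ^ 2 * cz ^ 3 + cy ^ 3 * cz ^ 2) * X ^ 10 + (cy ^ 2 * cz ^ 3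 - (cy ^ 3 * cz ^ 2) - 2 * cy ^ 3 * cz ^ 3) * X ^ 11 + (cy ^ 3 * cz ^ 3) * X ^ 12 + (cy ^ 3 * cz ^ 3) * X ^ 13 + (-(cy ^ 3 * cz ^ 3)) * X ^ 14 + (cy ^ 3 * cz ^ 3) * X ^ 15) * qY cy * qY cz
  | true => ((1) + (2) * X + (2 - (cz) + cy) * X ^ 2 + (2 * cz) * X ^ 3 + (2 * cz - 3 * cy * cz) * X ^ 4 + (4 * cz - 4 * cy * cz) * X ^ 5 + (cy * cz + 2 * cy * cz ^ 2 - 2 * cy ^ 2 * cz) * X ^ 6 + (-4 * cy * cz ^ 2) * X ^ 7 + (2 * cy * cz - 2 * cy * cz ^ 2 + 3 * cy ^ 2 * cz ^ 2) * X ^ 8 + (2 * cy * cz ^ 2 + 2 * cy ^ 2 * cz ^ 2) * X ^ 9 + (-6 * cy ^ 2 * cz ^ 2 - (cy ^ 2 * cz ^ 3) + cy ^ 3 * cz ^ 2) * X ^ 10 + (-2 * cy ^ 2 * cz ^ 2 + 2 * cy ^ 2 * cz ^ 3) * X ^ 11 + (2 * cy ^ 2 * cz ^ 2 + 2 * cy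 ^ 2 * cz ^ 3 - (cy ^ 3 * cz ^ 3)) * X ^ 12 + (-2 * cy ^ 2 * cz ^ 3) * X ^ 13 + (cy ^ 3 * cz ^ 3) * X ^ 14) * qY cy * qY cz

/-- Numerator for the states `iniE` (bottom row; machine-found, verified below). [cite: Stanley2012EC1, §4.7] -/
def polIniE (cy cz : ℝ⟦X⟧) (p : Bool) (i : ℕ) : ℝ⟦X⟧ :=
  match p with
  | false => ((1) + (1) * X + (1 - 2 * cz) * X ^ 2 + (cz ^ 2 - (cy * cz)) * X ^ 4 + (cz - (cz ^ 2) - (cy * cz)) * X ^ 5 + (-(cz ^ 2) + 2 * cy * cz ^ 2) * X ^ 6 + (-(cz ^ 2)) * X ^ 7 + (-(cy * cz ^ 2) - (cy * cz ^ 3)) * X ^ 8 + (cy * cz ^ 3) * X ^ 9 + (-(cy * cz ^ 2) + cy * cz ^ 3) * X ^ 10 + (-(cy * cz ^ 3)) * X ^ 11) * qY cy * qC cy cz + X ^ (2 * i) * cz ^ i * (((cz ^ 2) * X ^ 7 + (2 * cy * cz ^ 2) * X ^ 8 + (-(cz ^ 3)) * X ^ 9 + (cy * cz ^ 2 - 2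 * cy * cz ^ 3 - (cy ^ 2 * cz ^ 2)) * X ^ 10 + (2 * cy * cz ^ 3) * X ^ 11 + (-(cy * cz ^ 4) - (cy ^ 2 * cz ^ 3)) * X ^ 13 + (cy ^ 2 * cz ^ 4) * X ^ 14 + (-(cy ^ 2 * cz ^ 4)) * X ^ 16) * qY cy)
  | true => ((1) + (1 + cy) * X + (-2 * cy * cz) * X ^ 3 + (cz - (cz ^ 2) - (cy * cz)) * X ^ 4 + (-(cz ^ 2) + cy * cz + cy * cz ^ 2 - (cy ^ 2 * cz)) * X ^ 5 + (-(cz ^ 2)) * X ^ 6 + (-2 * cy * cz ^ 2 + 2 * cy ^ 2 * cz ^ 2) * X ^ 7 + (cy * cz ^ 3) * X ^ 8 + (-(cy * cz ^ 2) + cy * cz ^ 3 - (cy ^ 2 * cz ^ 2) - (cy ^ 2 * cz ^ 3)) * X ^ 9 + (-(cy * cz ^ 3)) * X ^ 10 + (cy ^ 2 * cz ^ 3) * X ^ 11) * qY cy * qC cy cz + X ^ (2 * i) * cz ^ i * (((cz) * X ^ 4 + (cy * cz) * X ^ 5 + (-(cz ^ 2)) * X ^ 6 + (cy * cz) * X ^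 7 + (2 * cy * cz ^ 2) * X ^ 8 + (-(cy * cz ^ 3) - 2 * cy ^ 2 * cz ^ 2) * X ^ 9 + (-(cy * cz ^ 3) - (cy ^ 2 * cz ^ 2)) * X ^ 10 + (cy ^ 2 * cz ^ 2 + 2 * cy ^ 2 * cz ^ 3) * X ^ 11 + (-2 * cy ^ 2 * cz ^ 3) * X ^ 13) * qY cy)

/-- Numerator for the states `iniO` (bottom row; machine-found, verified below). [cite: Stanley2012EC1, §4.7] -/
def polIniO (cy cz : ℝ⟦X⟧) (p : Bool) (i : ℕ) : ℝ⟦X⟧ :=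
  match p with
  | false => ((1) + (1 + cy) * X + (-2 * cy * cz) * X ^ 3 + (cz - (cz ^ 2) - (cy * cz)) * X ^ 4 + (-(cz ^ 2) + cy * cz + cy * cz ^ 2 - (cy ^ 2 * cz)) * X ^ 5 + (-(cz ^ 2)) * X ^ 6 + (-2 * cy * cz ^ 2 + 2 * cy ^ 2 * cz ^ 2) * X ^ 7 + (cy * cz ^ 3) * X ^ 8 + (-(cy * cz ^ 2) + cy * cz ^ 3 - (cy ^ 2 * cz ^ 2) - (cy ^ 2 * cz ^ 3)) * X ^ 9 + (-(cy * cz ^ 3)) * X ^ 10 + (cy ^ 2 * cz ^ 3) * X ^ 11) * qY cy * qC cy cz + X ^ (2 * i + 1) * cz ^ i * (((cz ^ 2) * X ^ 5 + (2 * cy * cz ^ 2) * X ^ 6 + (-(cz ^ 3)) * X ^ 7 + (cy * cz ^ 2 - 2 * cy * cz ^ 3 - (cy ^ 2 * cz ^ 2)) * X ^ 8 + (2 * cy * cz ^ 3) * X ^ 9 + (-(cy * cz ^ 4) - (cy ^ 2 * cz ^ 3)) * X ^ 11 + (cy ^ 2 * cz ^ 4) * X ^ 12 + (-(cy ^ 2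 * cz ^ 4)) * X ^ 14) * qY cy)
  | true => ((1) + (1) * X + (1 - 2 * cz) * X ^ 2 + (cz ^ 2 - (cy * cz)) * X ^ 4 + (cz - (cz ^ 2) - (cy * cz)) * X ^ 5 + (-(cz ^ 2) + 2 * cy * cz ^ 2) * X ^ 6 + (-(cz ^ 2)) * X ^ 7 + (-(cy * cz ^ 2) - (cy * cz ^ 3)) * X ^ 8 + (cy * cz ^ 3) * X ^ 9 + (-(cy * cz ^ 2) + cy * cz ^ 3) * X ^ 10 + (-(cy * cz ^ 3)) * X ^ 11) * qY cy * qC cy cz + X ^ (2 * i + 1) * cz ^ i * (((cz ^ 2) * X ^ 6 + (cy * cz ^ 2) * X ^ 7 + (-(cz ^ 3)) * X ^ 8 + (cy * cz ^ 2) * X ^ 9 + (2 * cy * cz ^ 3) * X ^ 10 + (-(cy * cz ^ 4) - 2 * cy ^ 2 * cz ^ 3) * X ^ 11 + (-(cy * cz ^ 4) - (cy ^ 2 * cz ^ 3)) * X ^ 12 + (cy ^ 2 * cz ^ 3 + 2 * cy ^ 2 * cz ^ 4) * X ^ 13 + (-2 * cy ^ 2 * cz ^ 4) * X ^ 15) *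 qY cy)

/-- Numerator for the states `rg1Z` (bottom row; machine-found, verified below). [cite: Stanley2012EC1, §4.7] -/
def polRg1Z (cy cz : ℝ⟦X⟧) (p : Bool) : ℝ⟦X⟧ :=
  match p with
  | false => ((1) + (2 * cy) * X + (-(cz) + cy) * X ^ 2 + (2 * cy - 2 * cy * cz) * X ^ 3 + (2 * cy * cz) * X ^ 4 + (-2 * cy ^ 2 * cz) * X ^ 5 + (cy * cz - (cy * cz ^ 2) - (cy ^ 2 * cz)) * X ^ 6 + (2 * cy ^ 2 * cz + 2 * cy ^ 2 * cz ^ 2) * X ^ 7 + (-(cy ^ 2 * cz ^ 2)) * X ^ 8 + (-2 * cy ^ 2 * cz ^ 2) * X ^ 9 + (cy ^ 2 * cz ^ 2) * X ^ 10) * qY cy * qY cz * qC cy cz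
  | true => ((1) + (2 * cy) * X + (-(cz) + cy) * X ^ 2 + (2 * cy - 2 * cy * cz) * X ^ 3 + (2 * cy * cz) * X ^ 4 + (-2 * cy ^ 2 * cz) * X ^ 5 + (cy * cz - (cy * cz ^ 2) - (cy ^ 2 * cz)) * X ^ 6 + (2 * cy ^ 2 * cz + 2 * cy ^ 2 * cz ^ 2) * X ^ 7 + (-(cy ^ 2 * cz ^ 2)) * X ^ 8 + (-2 * cy ^ 2 * cz ^ 2) * X ^ 9 + (cy ^ 2 * cz ^ 2) * X ^ 10) * qY cy * qY cz * qC cy cz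

/-- Numerator for the states `rg1O` (bottom row; machine-found, verified below). [cite: Stanley2012EC1, §4.7] -/
def polRg1O (cy cz : ℝ⟦X⟧) (p : Bool) (i : ℕ) : ℝ⟦X⟧ :=
  match p with
  | false => ((1) + (1 + cy) * X + (-(cz)) * X ^ 2 + (-(cz) - (cy * cz) - (cy ^ 2)) * X ^ 3 + (cy * cz - (cy ^ 2)) * X ^ 4 + (-(cy ^ 2)) * X ^ 5 + (-(cy ^ 2 * cz)) * X ^ 6 + (-(cy * cz) + cy * cz ^ 2 + 2 * cy ^ 2 * cz + cy ^ 2 * cz ^ 2 + cy ^ 3 * cz) * X ^ 7 + (-(cy ^ 2 * cz) + cy ^ 3 * cz) * X ^ 8 + (-2 * cy ^ 2 * cz ^ 2 - (cy ^ 3 * cz) - (cy ^ 3 * cz ^ 2)) * X ^ 9 + (cy ^ 2 * cz ^ 2) * X ^ 10 + (cy ^ 2 * cz ^ 2 + cy ^ 3 * cz ^ 2) * X ^ 11) * qY cz * qC cy cz + X ^ (2 * i + 1) * cy ^ i * (((cy) * X ^ 3 + (2 * cy * cz) * X ^ 4 + (-(cy ^ 2)) * X ^ 5 + (cy * cz -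 (cy * cz ^ 2) - 2 * cy ^ 2 * cz) * X ^ 6 + (2 * cy ^ 2 * cz) * X ^ 7 + (-(cy ^ 2 * cz ^ 2) - (cy ^ 3 * cz)) * X ^ 9 + (cy ^ 3 * cz ^ 2) * X ^ 10 + (-(cy ^ 3 * cz ^ 2)) * X ^ 12) * qY cz * qC cy cz)
  | true => ((1) + (2 * cy) * X + (-(cz)) * X ^ 2 + (cy - 2 * cy * cz - 2 * cy ^ 2) * X ^ 3 + (cy * cz - (cy ^ 2)) * X ^ 4 + (-(cy ^ 2)) * X ^ 5 + (-(cy ^ 2 * cz)) * X ^ 6 + (2 * cy ^ 2 * cz ^ 2 + 2 * cy ^ 3 * cz) * X ^ 7 + (-(cy ^ 2 * cz) + cy ^ 3 * cz) * X ^ 8 + (-(cy ^ 2 * cz ^ 2) - (cy ^ 3 * cz) - 2 * cy ^ 3 * cz ^ 2) * X ^ 9 + (cy ^ 2 * cz ^ 2) * X ^ 10 + (2 * cy ^ 3 * cz ^ 2) * X ^ 11) * qY cz * qC cy cz + X ^ (2 * i + 1) * cy ^ i * (((cy) * X ^ 2 + (cy * cz) * X ^ 3 + (-(cy ^ 2))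 * X ^ 4 + (cy * cz) * X ^ 5 + (2 * cy ^ 2 * cz) * X ^ 6 + (-2 * cy ^ 2 * cz ^ 2 - (cy ^ 3 * cz)) * X ^ 7 + (-(cy ^ 2 * cz ^ 2) - (cy ^ 3 * cz)) * X ^ 8 + (cy ^ 2 * cz ^ 2 + 2 * cy ^ 3 * cz ^ 2) * X ^ 9 + (-2 * cy ^ 3 * cz ^ 2) * X ^ 11) * qY cz * qC cy cz)

/-- Numerator for the states `rg1E` (bottom row; machine-found, verified below). [cite: Stanley2012EC1, §4.7] -/
def polRg1E (cy cz : ℝ⟦X⟧) (p : Bool) (i : ℕ) : ℝ⟦X⟧ :=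
  match p with
  | false => ((1) + (2 * cy) * X + (-(cz)) * X ^ 2 + (cy - 2 * cy * cz - 2 * cy ^ 2) * X ^ 3 + (cy * cz - (cy ^ 2)) * X ^ 4 + (-(cy ^ 2)) * X ^ 5 + (-(cy ^ 2 * cz)) * X ^ 6 + (2 * cy ^ 2 * cz ^ 2 + 2 * cy ^ 3 * cz) * X ^ 7 + (-(cy ^ 2 * cz) + cy ^ 3 * cz) * X ^ 8 + (-(cy ^ 2 * cz ^ 2) - (cy ^ 3 * cz) - 2 * cy ^ 3 * cz ^ 2) * X ^ 9 + (cy ^ 2 * cz ^ 2) * X ^ 10 + (2 * cy ^ 3 * cz ^ 2) * X ^ 11) * qY cz * qC cy cz + X ^ (2 * i + 2) * cy ^ i * (((cy ^ 2) * X ^ 3 + (2 * cy ^ 2 * cz) * X ^ 4 + (-(cy ^ 3)) * X ^ 5 + (cy ^ 2 * cz - (cy ^ 2 * cz ^ 2) - 2 * cy ^ 3 * cz) * X ^ 6 + (2 * cy ^ 3 * cz) * X ^ 7 + (-(cy ^ 3 * cz ^ 2) - (cy ^ 4 * cz)) * X ^ 9 + (cy ^ 4 * cz ^ 2) * X ^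 10 + (-(cy ^ 4 * cz ^ 2)) * X ^ 12) * qY cz * qC cy cz)
  | true => ((1) + (1 + cy) * X + (-(cz)) * X ^ 2 + (-(cz) - (cy * cz) - (cy ^ 2)) * X ^ 3 + (cy * cz - (cy ^ 2)) * X ^ 4 + (-(cy ^ 2)) * X ^ 5 + (-(cy ^ 2 * cz)) * X ^ 6 + (-(cy * cz) + cy * cz ^ 2 + 2 * cy ^ 2 * cz + cy ^ 2 * cz ^ 2 + cy ^ 3 * cz) * X ^ 7 + (-(cy ^ 2 * cz) + cy ^ 3 * cz) * X ^ 8 + (-2 * cy ^ 2 * cz ^ 2 - (cy ^ 3 * cz) - (cy ^ 3 * cz ^ 2)) * X ^ 9 + (cy ^ 2 * cz ^ 2) * X ^ 10 + (cy ^ 2 * cz ^ 2 + cy ^ 3 * cz ^ 2) * X ^ 11) * qY cz * qC cy cz + X ^ (2 * i + 2) * cy ^ i * (((cy) * X ^ 2 + (cy * cz) * X ^ 3 + (-(cy ^ 2)) * X ^ 4 + (cy * cz) * X ^ 5 + (2 * cy ^ 2 * cz) * X ^ 6 + (-2 * cy ^ 2 * cz ^ 2 - (cy ^ 3 * cz))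 * X ^ 7 + (-(cy ^ 2 * cz ^ 2) - (cy ^ 3 * cz)) * X ^ 8 + (cy ^ 2 * cz ^ 2 + 2 * cy ^ 3 * cz ^ 2) * X ^ 9 + (-2 * cy ^ 3 * cz ^ 2) * X ^ 11) * qY cz * qC cy cz)

/-- Numerator for the states `utE` (bottom row; machine-found, verified below). [cite: Stanley2012EC1, §4.7] -/
def polUtE (cy cz : ℝ⟦X⟧) (p : Bool) (i : ℕ) : ℝ⟦X⟧ :=
  match p with
  | false => ((1) + (cy) * X) * qY cz * qE cy cz * qC cy cz * qC cy cz + X ^ (2 * i) * cy ^ i * (((cy) * X ^ 3 + (2 * cy * cz) * X ^ 4 + (-(cy ^ 2)) * X ^ 5 + (cy * cz - (cy * cz ^ 2) - 2 * cy ^ 2 * cz) * X ^ 6 + (2 * cy ^ 2 * cz) * X ^ 7 + (-(cy ^ 2 * cz ^ 2) - (cy ^ 3 * cz)) * X ^ 9 + (cy ^ 3 * cz ^ 2) * X ^ 10 + (-(cy ^ 3 * cz ^ 2)) * X ^ 12) * qY cz * qC cy cz)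
  | true => ((1) + (1) * X) * qY cz * qE cy cz * qC cy cz * qC cy cz + X ^ (2 * i) * cy ^ i * (((1) * X ^ 2 + (cz) * X ^ 3 + (-(cy)) * X ^ 4 + (cz) * X ^ 5 + (2 * cy * cz) * X ^ 6 + (-2 * cy * cz ^ 2 - (cy ^ 2 * cz)) * X ^ 7 + (-(cy * cz ^ 2) - (cy ^ 2 * cz)) * X ^ 8 + (cy * cz ^ 2 + 2 * cy ^ 2 * cz ^ 2) * X ^ 9 + (-2 * cy ^ 2 * cz ^ 2) * X ^ 11) * qY cz * qC cy cz)

/-- Numerator for the states `utO` (bottom row; machine-found, verified below). [cite: Stanley2012EC1, §4.7] -/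
def polUtO (cy cz : ℝ⟦X⟧) (p : Bool) (i : ℕ) : ℝ⟦X⟧ :=
  match p with
  | false => ((1) + (1) * X) * qY cz * qE cy cz * qC cy cz * qC cy cz + X ^ (2 * i + 1) * cy ^ i * (((cy) * X ^ 3 + (2 * cy * cz) * X ^ 4 + (-(cy ^ 2)) * X ^ 5 + (cy * cz - (cy * cz ^ 2) - 2 * cy ^ 2 * cz) * X ^ 6 + (2 * cy ^ 2 * cz) * X ^ 7 + (-(cy ^ 2 * cz ^ 2) - (cy ^ 3 * cz)) * X ^ 9 + (cy ^ 3 * cz ^ 2) * X ^ 10 + (-(cy ^ 3 * cz ^ 2)) * X ^ 12) * qY cz * qC cy cz)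
  | true => ((1) + (cy) * X) * qY cz * qE cy cz * qC cy cz * qC cy cz + X ^ (2 * i + 1) * cy ^ i * (((cy) * X ^ 2 + (cy * cz) * X ^ 3 + (-(cy ^ 2)) * X ^ 4 + (cy * cz) * X ^ 5 + (2 * cy ^ 2 * cz) * X ^ 6 + (-2 * cy ^ 2 * cz ^ 2 - (cy ^ 3 * cz)) * X ^ 7 + (-(cy ^ 2 * cz ^ 2) - (cy ^ 3 * cz)) * X ^ 8 + (cy ^ 2 * cz ^ 2 + 2 * cy ^ 3 * cz ^ 2) * X ^ 9 + (-2 * cy ^ 3 * cz ^ 2) * X ^ 11) * qY cz * qC cy cz)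

/-- Numerator for the states `upE` (bottom row; machine-found, verified below). [cite: Stanley2012EC1, §4.7] -/
def polUpE (cy cz : ℝ⟦X⟧) (p : Bool) (i : ℕ) : ℝ⟦X⟧ :=
  match p with
  | false => ((1) + (1) * X + (1 - 2 * cz) * X ^ 2 + (cz ^ 2 - (cy * cz)) * X ^ 4 + (cz - (cz ^ 2) - (cy * cz)) * X ^ 5 + (-(cz ^ 2) + 2 * cy * cz ^ 2) * X ^ 6 + (-(cz ^ 2)) * X ^ 7 + (-(cy * cz ^ 2) - (cy * cz ^ 3)) * X ^ 8 + (cy * cz ^ 3) * X ^ 9 + (-(cy * cz ^ 2) + cy * cz ^ 3) * X ^ 10 + (-(cy * cz ^ 3)) * X ^ 11) * qY cy * qC cy cz + X ^ (2 * i) * cz ^ i * (((-(cz)) * X ^ 4 + (-(cz ^ 2)) * X ^ 5) * qY cy * qE cy cz * qC cy cz)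
  | true => ((1) + (1 + cy) * X + (-2 * cy * cz) * X ^ 3 + (cz - (cz ^ 2) - (cy * cz)) * X ^ 4 + (-(cz ^ 2) + cy * cz + cy * cz ^ 2 - (cy ^ 2 * cz)) * X ^ 5 + (-(cz ^ 2)) * X ^ 6 + (-2 * cy * cz ^ 2 + 2 * cy ^ 2 * cz ^ 2) * X ^ 7 + (cy * cz ^ 3) * X ^ 8 + (-(cy * cz ^ 2) + cy * cz ^ 3 - (cy ^ 2 * cz ^ 2) - (cy ^ 2 * cz ^ 3)) * X ^ 9 + (-(cy * cz ^ 3)) * X ^ 10 + (cy ^ 2 * cz ^ 3) * X ^ 11) * qY cy * qC cy cz + X ^ (2 * i) * cz ^ i * (((-(cz)) * X ^ 2 + (-(cz)) * X ^ 3) * qY cy * qE cy cz * qC cy cz)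

/-- Numerator for the states `upO` (bottom row; machine-found, verified below). [cite: Stanley2012EC1, §4.7] -/
def polUpO (cy cz : ℝ⟦X⟧) (p : Bool) (i : ℕ) : ℝ⟦X⟧ :=
  match p with
  | false => ((1) + (1 + cy) * X + (-2 * cy * cz) * X ^ 3 + (cz - (cz ^ 2) - (cy * cz)) * X ^ 4 + (-(cz ^ 2) + cy * cz + cy * cz ^ 2 - (cy ^ 2 * cz)) * X ^ 5 + (-(cz ^ 2)) * X ^ 6 + (-2 * cy * cz ^ 2 + 2 * cy ^ 2 * cz ^ 2) * X ^ 7 + (cy * cz ^ 3) * X ^ 8 + (-(cy * cz ^ 2) + cy * cz ^ 3 - (cy ^ 2 * cz ^ 2) - (cy ^ 2 * cz ^ 3)) * X ^ 9 + (-(cy * cz ^ 3)) * X ^ 10 + (cy ^ 2 * cz ^ 3) * X ^ 11) * qY cy * qC cy cz + X ^ (2 * i + 1) * cz ^ i * (((-(cz)) * X ^ 2 + (-(cz ^ 2)) * X ^ 3) * qY cy * qE cy cz * qC cy cz)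
  | true => ((1) + (1) * X + (1 - 2 * cz) * X ^ 2 + (cz ^ 2 - (cy * cz)) * X ^ 4 + (cz - (cz ^ 2) - (cy * cz)) * X ^ 5 + (-(cz ^ 2) + 2 * cy * cz ^ 2) * X ^ 6 + (-(cz ^ 2)) * X ^ 7 + (-(cy * cz ^ 2) - (cy * cz ^ 3)) * X ^ 8 + (cy * cz ^ 3) * X ^ 9 + (-(cy * cz ^ 2) + cy * cz ^ 3) * X ^ 10 + (-(cy * cz ^ 3)) * X ^ 11) * qY cy * qC cy cz + X ^ (2 * i + 1) * cz ^ i * (((-(cz ^ 2)) * X ^ 4 + (-(cz ^ 2)) * X ^ 5) * qY cy * qE cy cz * qC cy cz)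

/-- Numerator for the states `fwdE` (bottom row; machine-found, verified below). [cite: Stanley2012EC1, §4.7] -/
def polFwdE (cy cz : ℝ⟦X⟧) (p : Bool) (i : ℕ) : ℝ⟦X⟧ :=
  match p with
  | false => ((1) + (1) * X + (1 - 2 * cz) * X ^ 2 + (cz ^ 2 - (cy * cz)) * X ^ 4 + (cz - (cz ^ 2) - (cy * cz)) * X ^ 5 + (-(cz ^ 2) + 2 * cy * cz ^ 2) * X ^ 6 + (-(cz ^ 2)) * X ^ 7 + (-(cy * cz ^ 2) - (cy * cz ^ 3)) * X ^ 8 + (cy * cz ^ 3) * X ^ 9 + (-(cy * cz ^ 2) + cy * cz ^ 3) * X ^ 10 + (-(cy * cz ^ 3)) * X ^ 11) * qY cy * qC cy cz + X ^ (2 * i) * cz ^ i * (((-(cz)) * X ^ 4 + (-(cz ^ 2)) * X ^ 5) * qY cy * qE cy cz * qC cy cz)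
  | true => ((1) + (1) * X + (1 - 2 * cz) * X ^ 2 + (cz ^ 2 - (cy * cz)) * X ^ 4 + (cz - (cz ^ 2) - (cy * cz)) * X ^ 5 + (-(cz ^ 2) + 2 * cy * cz ^ 2) * X ^ 6 + (-(cz ^ 2)) * X ^ 7 + (-(cy * cz ^ 2) - (cy * cz ^ 3)) * X ^ 8 + (cy * cz ^ 3) * X ^ 9 + (-(cy * cz ^ 2) + cy * cz ^ 3) * X ^ 10 + (-(cy * cz ^ 3)) * X ^ 11) * qY cy * qC cy cz + X ^ (2 * i) * cz ^ i * (((-(cz)) * X ^ 4 + (-(cz ^ 2)) * X ^ 5) * qY cy * qE cy cz * qC cy cz)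

/-- Numerator for the states `fwdO` (bottom row; machine-found, verified below). [cite: Stanley2012EC1, §4.7] -/
def polFwdO (cy cz : ℝ⟦X⟧) (p : Bool) (i : ℕ) : ℝ⟦X⟧ :=
  match p with
  | false => ((1) + (1 + cy) * X + (-2 * cy * cz) * X ^ 3 + (cz - (cz ^ 2) - (cy * cz)) * X ^ 4 + (-(cz ^ 2) + cy * cz + cy * cz ^ 2 - (cy ^ 2 * cz)) * X ^ 5 + (-(cz ^ 2)) * X ^ 6 + (-2 * cy * cz ^ 2 + 2 * cy ^ 2 * cz ^ 2) * X ^ 7 + (cy * cz ^ 3) * X ^ 8 + (-(cy * cz ^ 2) + cy * cz ^ 3 - (cy ^ 2 * cz ^ 2) - (cy ^ 2 * cz ^ 3)) * X ^ 9 + (-(cy * cz ^ 3)) * X ^ 10 + (cy ^ 2 * cz ^ 3) * X ^ 11) * qY cy * qC cy cz + X ^ (2 * i + 1) * cz ^ i * (((-(cz)) * X ^ 2 + (-(cz ^ 2)) * X ^ 3) * qY cy * qE cy cz * qC cy cz)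
  | true => ((1) + (1 + cy) * X + (-2 * cy * cz) * X ^ 3 + (cz - (cz ^ 2) - (cy * cz)) * X ^ 4 + (-(cz ^ 2) + cy * cz + cy * cz ^ 2 - (cy ^ 2 * cz)) * X ^ 5 + (-(cz ^ 2)) * X ^ 6 + (-2 * cy * cz ^ 2 + 2 * cy ^ 2 * cz ^ 2) * X ^ 7 + (cy * cz ^ 3) * X ^ 8 + (-(cy * cz ^ 2) + cy * cz ^ 3 - (cy ^ 2 * cz ^ 2) - (cy ^ 2 * cz ^ 3)) * X ^ 9 + (-(cy * cz ^ 3)) * X ^ 10 + (cy ^ 2 * cz ^ 3) * X ^ 11) * qY cy * qC cy cz + X ^ (2 * i + 1) * cz ^ i * (((-(cz)) * X ^ 2 + (-(cz ^ 2)) * X ^ 3) * qY cy * qE cy cz * qC cy cz)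

/-- Numerator for the states `rg2E` (bottom row; machine-found, verified below). [cite: Stanley2012EC1, §4.7] -/
def polRg2E (cy cz : ℝ⟦X⟧) (p : Bool) (i : ℕ) : ℝ⟦X⟧ :=
  match p with
  | false => ((1) + (2 * cy) * X + (-(cz)) * X ^ 2 + (cy - 2 * cy * cz - 2 * cy ^ 2) * X ^ 3 + (cy * cz - (cy ^ 2)) * X ^ 4 + (-(cy ^ 2)) * X ^ 5 + (-(cy ^ 2 * cz)) * X ^ 6 + (2 * cy ^ 2 * cz ^ 2 + 2 * cy ^ 3 * cz) * X ^ 7 + (-(cy ^ 2 * cz) + cy ^ 3 * cz) * X ^ 8 + (-(cy ^ 2 * cz ^ 2) - (cy ^ 3 * cz) - 2 * cy ^ 3 * cz ^ 2) * X ^ 9 + (cy ^ 2 * cz ^ 2) * X ^ 10 + (2 * cy ^ 3 * cz ^ 2) * X ^ 11) * qY cz * qC cy cz + X ^ (2 * i) * cy ^ i * (((-(cy)) * X + (-(cy)) * X ^ 2) * qY cz * qE cy cz * qC cy cz * qC cy cz)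
  | true => ((1) + (2 * cy) * X + (-(cz)) * X ^ 2 + (cy - 2 * cy * cz - 2 * cy ^ 2) * X ^ 3 + (cy * cz - (cy ^ 2)) * X ^ 4 + (-(cy ^ 2)) * X ^ 5 + (-(cy ^ 2 * cz)) * X ^ 6 + (2 * cy ^ 2 * cz ^ 2 + 2 * cy ^ 3 * cz) * X ^ 7 + (-(cy ^ 2 * cz) + cy ^ 3 * cz) * X ^ 8 + (-(cy ^ 2 * cz ^ 2) - (cy ^ 3 * cz) - 2 * cy ^ 3 * cz ^ 2) * X ^ 9 + (cy ^ 2 * cz ^ 2) * X ^ 10 + (2 * cy ^ 3 * cz ^ 2) * X ^ 11) * qY cz * qC cy cz + X ^ (2 * i) * cy ^ i * (((-(cy)) * X + (-(cy)) * X ^ 2) * qY cz * qE cy cz * qC cy cz * qC cy cz)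

/-- Numerator for the states `rg2O` (bottom row; machine-found, verified below). [cite: Stanley2012EC1, §4.7] -/
def polRg2O (cy cz : ℝ⟦X⟧) (p : Bool) (i : ℕ) : ℝ⟦X⟧ :=
  match p with
  | false => ((1) + (2 * cy) * X + (-(cz)) * X ^ 2 + (cy - 2 * cy * cz - 2 * cy ^ 2) * X ^ 3 + (cy * cz - (cy ^ 2)) * X ^ 4 + (-(cy ^ 2)) * X ^ 5 + (-(cy ^ 2 * cz)) * X ^ 6 + (2 * cy ^ 2 * cz ^ 2 + 2 * cy ^ 3 * cz) * X ^ 7 + (-(cy ^ 2 * cz) + cy ^ 3 * cz) * X ^ 8 + (-(cy ^ 2 * cz ^ 2) - (cy ^ 3 * cz) - 2 * cy ^ 3 * cz ^ 2) * X ^ 9 + (cy ^ 2 * cz ^ 2) * X ^ 10 + (2 * cy ^ 3 * cz ^ 2) * X ^ 11) * qY cz * qC cy cz + X ^ (2 * i + 1) * cy ^ i * (((-(cy)) * X + (-(cy ^ 2)) * X ^ 2) * qY cz * qE cy cz * qC cy cz * qC cy cz)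
  | true => ((1) + (2 * cy) * X + (-(cz)) * X ^ 2 + (cy - 2 * cy * cz - 2 * cy ^ 2) * X ^ 3 + (cy * cz - (cy ^ 2)) * X ^ 4 + (-(cy ^ 2)) * X ^ 5 + (-(cy ^ 2 * cz)) * X ^ 6 + (2 * cy ^ 2 * cz ^ 2 + 2 * cy ^ 3 * cz) * X ^ 7 + (-(cy ^ 2 * cz) + cy ^ 3 * cz) * X ^ 8 + (-(cy ^ 2 * cz ^ 2) - (cy ^ 3 * cz) - 2 * cy ^ 3 * cz ^ 2) * X ^ 9 + (cy ^ 2 * cz ^ 2) * X ^ 10 + (2 * cy ^ 3 * cz ^ 2) * X ^ 11) * qY cz * qC cy cz + X ^ (2 * i + 1) * cy ^ i * (((-(cy)) * X + (-(cy ^ 2)) * X ^ 2) * qY cz * qE cy cz * qC cy cz * qC cy cz)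

/-- Numerator for the states `corE` (bottom row; machine-found, verified below). [cite: Stanley2012EC1, §4.7] -/
def polCorE (cy cz : ℝ⟦X⟧) (p : Bool) (i : ℕ) (c : Bool) : ℝ⟦X⟧ :=
  match p, c with
  | false, false => ((1) + (cy) * X) * qY cz * qE cy cz * qC cy cz * qC cy cz + X ^ (2 * i) * cy ^ i * (((-(cy)) * X + (-(cy)) * X ^ 2) * qY cz * qE cy cz * qC cy cz * qC cy cz)
  | false, true => ((1) + (1) * X) * qY cz * qE cy cz * qC cy cz * qC cy cz + X ^ (2 * i) * cy ^ i * (((-1) * X + (-(cy)) * X ^ 2) * qY cz * qE cy cz * qC cy cz * qC cy cz)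
  | true, false => ((1) + (cy) * X) * qY cz * qE cy cz * qC cy cz * qC cy cz + X ^ (2 * i) * cy ^ i * (((-(cy)) * X + (-(cy)) * X ^ 2) * qY cz * qE cy cz * qC cy cz * qC cy cz)
  | true, true => ((1) + (1) * X) * qY cz * qE cy cz * qC cy cz * qC cy cz + X ^ (2 * i) * cy ^ i * (((-1) * X + (-(cy)) * X ^ 2) * qY cz * qE cy cz * qC cy cz * qC cy cz)

/-- Numerator for the states `corO` (bottom row; machine-found, verified below). [cite: Stanley2012EC1, §4.7] -/
def polCorO (cy cz : ℝ⟦X⟧) (p : Bool) (i : ℕ) (c : Bool) : ℝ⟦X⟧ :=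
  match p, c with
  | false, false => ((1) + (cy) * X) * qY cz * qE cy cz * qC cy cz * qC cy cz + X ^ (2 * i + 1) * cy ^ i * (((-(cy)) * X + (-(cy ^ 2)) * X ^ 2) * qY cz * qE cy cz * qC cy cz * qC cy cz)
  | false, true => ((1) + (1) * X) * qY cz * qE cy cz * qC cy cz * qC cy cz + X ^ (2 * i + 1) * cy ^ i * (((-(cy)) * X + (-(cy)) * X ^ 2) * qY cz * qE cy cz * qC cy cz * qC cy cz)
  | true, false => ((1) + (cy) * X) * qY cz * qE cy cz * qC cy cz * qC cy cz + X ^ (2 * i + 1) * cy ^ i * (((-(cy)) * X + (-(cy ^ 2)) * X ^ 2) * qY cz * qE cy cz * qC cy cz * qC cy cz)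
  | true, true => ((1) + (1) * X) * qY cz * qE cy cz * qC cy cz * qC cy cz + X ^ (2 * i + 1) * cy ^ i * (((-(cy)) * X + (-(cy)) * X ^ 2) * qY cz * qE cy cz * qC cy cz * qC cy cz)

/-- The numerators, by state. [cite: Stanley2012EC1, §4.7 (transfer-matrix method)] -/
def pol (cy cz : ℝ⟦X⟧) (p : Bool) : S2 → ℝ⟦X⟧
  | start => polStart cy cz p
  | iniE i => polIniE cy cz p i
  | iniO i => polIniO cy cz p i
  | rg1Z => polRg1Z cy cz p
  | rg1O i => polRg1O cy cz p i
  | rg1E i => polRg1E cy cz p i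
  | utE i => polUtE cy cz p i
  | utO i => polUtO cy cz p i
  | upE i => polUpE cy cz p i
  | upO i => polUpO cy cz p i
  | fwdE i => polFwdE cy cz p i
  | fwdO i => polFwdO cy cz p i
  | rg2E i => polRg2E cy cz p i
  | rg2O i => polRg2O cy cz p i
  | corE i c => polCorE cy cz p i c
  | corO i c => polCorO cy cz p i c

/-- The closed form of a state series: `Ψ p s ρ = pol p s · D₂⁻¹`, with `y` and `z` exchanged on the top row.
[cite: Stanley2012EC1, §4.7 (transfer-matrix method)] -/
def Ψ (p : Bool) (s : S2) (ρ : Bool) : ℝ⟦X⟧ :=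
  pol (bif ρ then C z else C y) (bif ρ then C y else C z) p s * uD y z

/-! ## §3 The one-step identities `Ψ p s ρ = 1 + X · stepP p (Ψ p) s ρ` -/

/-- One-step identity at `start`. [cite: Stanley2012EC1, §4.7] -/
theorem Ψ_start (p : Bool) (ρ : Bool) :
    Ψ y z p start ρ = 1 + X * stepP y z p (Ψ y z p) start ρ := by
  cases p <;> cases ρ <;> simp only [Ψ, pol, stepP, polStart, polIniE, polRg1Z, wρ, cond_true, cond_false, Bool.not_true, Bool.not_false, qY, qC] <;> linear_combination huD y z

/-- One-step identity at `iniE` (var). [cite: Stanley2012EC1, §4.7] -/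
theorem Ψ_iniE (p : Bool) (i : ℕ) (ρ : Bool) :
    Ψ y z p (iniE i) ρ = 1 + X * stepP y z p (Ψ y z p) (iniE i) ρ := by
  cases p <;> cases ρ <;> simp only [Ψ, pol, stepP, polIniE, polIniO, polRg1O, wρ, cond_true, cond_false, Bool.not_true, Bool.not_false, qY, qC] <;> linear_combination huD y z

/-- One-step identity at `iniO` (var). [cite: Stanley2012EC1, §4.7] -/
theorem Ψ_iniO (p : Bool) (i : ℕ) (ρ : Bool) :
    Ψ y z p (iniO i) ρ = 1 + X * stepP y z p (Ψ y z p) (iniO i) ρ := by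
  cases p <;> cases ρ <;> simp only [Ψ, pol, stepP, polIniO, polIniE, polRg1E, wρ, cond_true, cond_false, Bool.not_true, Bool.not_false, qY, qC] <;> linear_combination huD y z

/-- One-step identity at `rg1Z`. [cite: Stanley2012EC1, §4.7] -/
theorem Ψ_rg1Z (p : Bool) (ρ : Bool) :
    Ψ y z p rg1Z ρ = 1 + X * stepP y z p (Ψ y z p) rg1Z ρ := by
  cases p <;> cases ρ <;> simp only [Ψ, pol, stepP, polRg1Z, polFwdE, wρ, cond_true, cond_false, qY, qE, qC] <;> linear_combination huD y z

/-- One-step identity at `rg1O` (var). [cite: Stanley2012EC1, §4.7] -/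
theorem Ψ_rg1O (p : Bool) (i : ℕ) (ρ : Bool) :
    Ψ y z p (rg1O i) ρ = 1 + X * stepP y z p (Ψ y z p) (rg1O i) ρ := by
  cases p <;> cases ρ <;> simp only [Ψ, pol, stepP, polRg1O, polFwdE, polUtE, wρ, cond_true, cond_false, qY, qE, qC] <;> linear_combination huD y z

/-- One-step identity at `rg1E` (var). [cite: Stanley2012EC1, §4.7] -/
theorem Ψ_rg1E (p : Bool) (i : ℕ) (ρ : Bool) :
    Ψ y z p (rg1E i) ρ = 1 + X * stepP y z p (Ψ y z p) (rg1E i) ρ := by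
  cases p <;> cases ρ <;> simp only [Ψ, pol, stepP, polRg1E, polFwdE, polUtO, wρ, cond_true, cond_false, qY, qE, qC] <;> linear_combination huD y z

/-- One-step identity at `utE` (zero). [cite: Stanley2012EC1, §4.7] -/
theorem Ψ_utE_zero (p : Bool) (ρ : Bool) :
    Ψ y z p (utE 0) ρ = 1 + X * stepP y z p (Ψ y z p) (utE 0) ρ := by
  cases p <;> cases ρ <;> simp only [Ψ, pol, stepP, polUtE, polUpE, wρ, cond_true, cond_false, qY, qE, qC] <;> linear_combination huD y z

/-- One-step identity at `utE` (succ). [cite: Stanley2012EC1, §4.7] -/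
theorem Ψ_utE_succ (p : Bool) (n : ℕ) (ρ : Bool) :
    Ψ y z p (utE (n + 1)) ρ = 1 + X * stepP y z p (Ψ y z p) (utE (n + 1)) ρ := by
  cases p <;> cases ρ <;> simp only [Ψ, pol, stepP, polUtE, polUtO, wρ, cond_true, cond_false, qY, qE, qC] <;> linear_combination huD y z

/-- One-step identity at `utO` (var). [cite: Stanley2012EC1, §4.7] -/
theorem Ψ_utO (p : Bool) (i : ℕ) (ρ : Bool) :
    Ψ y z p (utO i) ρ = 1 + X * stepP y z p (Ψ y z p) (utO i) ρ := by
  cases p <;> cases ρ <;> simp only [Ψ, pol, stepP, polUtO, polUtE, wρ, cond_true, cond_false, qY, qE, qC] <;> linear_combination huD y z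

/-- One-step identity at `upE` (var). [cite: Stanley2012EC1, §4.7] -/
theorem Ψ_upE (p : Bool) (i : ℕ) (ρ : Bool) :
    Ψ y z p (upE i) ρ = 1 + X * stepP y z p (Ψ y z p) (upE i) ρ := by
  cases p <;> cases ρ <;> simp only [Ψ, pol, stepP, polUpE, polRg2E, polUpO, wρ, cond_true, cond_false, Bool.not_true, Bool.not_false, qY, qE, qC] <;> linear_combination huD y z

/-- One-step identity at `upO` (var). [cite: Stanley2012EC1, §4.7] -/
theorem Ψ_upO (p : Bool) (i : ℕ) (ρ : Bool) :
    Ψ y z p (upO i) ρ = 1 + X * stepP y z p (Ψ y z p) (upO i) ρ := by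
  cases p <;> cases ρ <;> simp only [Ψ, pol, stepP, polUpO, polRg2O, polUpE, wρ, cond_true, cond_false, Bool.not_true, Bool.not_false, qY, qE, qC] <;> linear_combination huD y z

/-- One-step identity at `fwdE` (var). [cite: Stanley2012EC1, §4.7] -/
theorem Ψ_fwdE (p : Bool) (i : ℕ) (ρ : Bool) :
    Ψ y z p (fwdE i) ρ = 1 + X * stepP y z p (Ψ y z p) (fwdE i) ρ := by
  cases p <;> cases ρ <;> simp only [Ψ, pol, stepP, polFwdE, polFwdO, cond_true, cond_false, qY, qE, qC] <;> linear_combination huD y z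

/-- One-step identity at `fwdO` (var). [cite: Stanley2012EC1, §4.7] -/
theorem Ψ_fwdO (p : Bool) (i : ℕ) (ρ : Bool) :
    Ψ y z p (fwdO i) ρ = 1 + X * stepP y z p (Ψ y z p) (fwdO i) ρ := by
  cases p <;> cases ρ <;> simp only [Ψ, pol, stepP, polFwdO, polFwdE, polRg2O, wρ, cond_true, cond_false, Bool.not_true, Bool.not_false, qY, qE, qC] <;> linear_combination huD y z

/-- One-step identity at `rg2E` (zero). [cite: Stanley2012EC1, §4.7] -/
theorem Ψ_rg2E_zero (p : Bool) (ρ : Bool) :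
    Ψ y z p (rg2E 0) ρ = 1 + X * stepP y z p (Ψ y z p) (rg2E 0) ρ := by
  cases p <;> cases ρ <;> simp only [Ψ, pol, stepP, polRg2E, polFwdE, wρ, cond_true, cond_false, qY, qE, qC] <;> linear_combination huD y z

/-- One-step identity at `rg2E` (succ). [cite: Stanley2012EC1, §4.7] -/
theorem Ψ_rg2E_succ (p : Bool) (n : ℕ) (ρ : Bool) :
    Ψ y z p (rg2E (n + 1)) ρ = 1 + X * stepP y z p (Ψ y z p) (rg2E (n + 1)) ρ := by
  cases p <;> cases ρ <;> simp only [Ψ, pol, stepP, polRg2E, polCorO, polFwdE, wρ, cond_true, cond_false, qY, qE, qC] <;> linear_combination huD y z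

/-- One-step identity at `rg2O` (var). [cite: Stanley2012EC1, §4.7] -/
theorem Ψ_rg2O (p : Bool) (i : ℕ) (ρ : Bool) :
    Ψ y z p (rg2O i) ρ = 1 + X * stepP y z p (Ψ y z p) (rg2O i) ρ := by
  cases p <;> cases ρ <;> simp only [Ψ, pol, stepP, polRg2O, polCorE, polFwdE, wρ, cond_true, cond_false, qY, qE, qC] <;> linear_combination huD y z

/-- One-step identity at `corE` (zero). [cite: Stanley2012EC1, §4.7] -/
theorem Ψ_corE_zero (p : Bool) (c : Bool) (ρ : Bool) :
    Ψ y z p (corE 0 c) ρ = 1 + X * stepP y z p (Ψ y z p) (corE 0 c) ρ := by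
  cases p <;> cases c <;> cases ρ <;> simp only [Ψ, pol, stepP, polCorE, cond_true, cond_false, qY, qE, qC] <;> linear_combination huD y z

/-- One-step identity at `corE` (succ). [cite: Stanley2012EC1, §4.7] -/
theorem Ψ_corE_succ (p : Bool) (n : ℕ) (c : Bool) (ρ : Bool) :
    Ψ y z p (corE (n + 1) c) ρ = 1 + X * stepP y z p (Ψ y z p) (corE (n + 1) c) ρ := by
  cases p <;> cases c <;> cases ρ <;> simp only [Ψ, pol, stepP, polCorE, polCorO, wρ, cond_true, cond_false, qY, qE, qC] <;> linear_combination huD y z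

/-- One-step identity at `corO` (var). [cite: Stanley2012EC1, §4.7] -/
theorem Ψ_corO (p : Bool) (i : ℕ) (c : Bool) (ρ : Bool) :
    Ψ y z p (corO i c) ρ = 1 + X * stepP y z p (Ψ y z p) (corO i c) ρ := by
  cases p <;> cases c <;> cases ρ <;> simp only [Ψ, pol, stepP, polCorO, polCorE, wρ, cond_true, cond_false, qY, qE, qC] <;> linear_combination huD y z

/-- ★ **All one-step identities: `Ψ p s ρ = 1 + X · stepP p (Ψ p) s ρ`.** [cite: Stanley2012EC1, §4.7 (Theorem 4.7.2)] -/
theorem Ψ_eq (p : Bool) (s : S2) (ρ : Bool) : Ψ y z p s ρ = 1 + X * stepP y z p (Ψ y z p) s ρ := by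
  rcases s with _ | i | i | _ | i | i | (_ | n) | i | i | i | i | i | (_ | n) | i | ⟨_ | n, c⟩ | ⟨i, c⟩
  · exact Ψ_start y z p ρ
  · exact Ψ_iniE y z p i ρ
  · exact Ψ_iniO y z p i ρ
  · exact Ψ_rg1Z y z p ρ
  · exact Ψ_rg1O y z p i ρ
  · exact Ψ_rg1E y z p i ρ
  · exact Ψ_utE_zero y z p ρ
  · exact Ψ_utE_succ y z p n ρ
  · exact Ψ_utO y z p i ρ
  · exact Ψ_upE y z p i ρ
  · exact Ψ_upO y z p i ρ
  · exact Ψ_fwdE y z p i ρ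
  · exact Ψ_fwdO y z p i ρ
  · exact Ψ_rg2E_zero y z p ρ
  · exact Ψ_rg2E_succ y z p n ρ
  · exact Ψ_rg2O y z p i ρ
  · exact Ψ_corE_zero y z p c ρ
  · exact Ψ_corE_succ y z p n c ρ
  · exact Ψ_corO y z p i c ρ

/-! ## §4 The state series are the closed forms -/

/-- ★★ **`[X^m] Ψ p s ρ = W₂ p s ρ m`** for every state, row and `m`. [cite: Stanley2012EC1, §4.7 (Theorem 4.7.2); AlmJanson1990] -/
theorem coeff_Ψ_eq_W₂ (p : Bool) (m : ℕ) (s : S2) (ρ : Bool) : coeff m (Ψ y z p s ρ) = W₂ y z p s ρ m := by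
  induction m generalizing s ρ with
  | zero => rw [Ψ_eq, map_add, coeff_zero_one, PowerSeries.coeff_zero_X_mul, add_zero, W₂_zero]
  | succ m ih =>
    rw [Ψ_eq, map_add, coeff_one, if_neg (Nat.succ_ne_zero m), zero_add, coeff_succ_X_mul, coeff_stepP, W₂_succ]
    exact congrArg (fun f => stepR y z p f s ρ) (funext fun t => funext fun ρ' => ih t ρ')

/-- ★★ **`Σ_m W₂ p s ρ m X^m = Ψ p s ρ`.** [cite: Stanley2012EC1, §4.7 (Theorem 4.7.2)] -/
theorem mk_W₂_eq_Ψ (p : Bool) (s : S2) (ρ : Bool) : PowerSeries.mk (fun m => W₂ y z p s ρ m) = Ψ y z p s ρ := by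
  ext m; rw [coeff_mk, coeff_Ψ_eq_W₂]

/-! ## §5 The two-fugacity walk series of the strip -/

/-- The weighted walk sums of the strip up to translation: four starting sites; the start `(1, 0)` / `(1, 1)` (odd column) is
itself weighted `y` / `z`. `twoWallZ y z N = W₂ 0 start ⊥ N + W₂ 0 start ⊤ N + y W₂ 1 start ⊥ N + z W₂ 1 start ⊤ N`.
[cite: BeatonBousquetMelouDeGierDuminilCopinGuttmann2014, §3.2 (arXiv v5 p. 10: C_{T,k}(y,z))] -/
def twoWallZ (N : ℕ) : ℝ :=
  W₂ y z false start false N + W₂ y z false start true N + y * W₂ y z true start false N + z * W₂ y z true start true N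

/-- The numerator `P(x; y, z)` of the two-fugacity series (x-degree 15, symmetric in `y, z`); at `y = z = 1`,
`P(x;1,1) = walkP(x)·(1 − x² + x³)` and `[(1−x²)² − x⁶](1−x⁴)² = (1−x²−x³)(1−x⁴)²·(1 − x² + x³)`, so the one-variable series of
`HexSAWBrickWallStripWidthOneSeries.lean` is the specialisation after cancelling `1 − x² + x³`.
[cite: BeatonBousquetMelouDeGierDuminilCopinGuttmann2014, §3.2 (arXiv v5 p. 12)] -/
def twoWallP : ℝ⟦X⟧ :=
  ((2 + C z + C y) + (2 + 4 * C z + 4 * C y) * X + (4 * C z + C z ^ 2 + 4 * C y - 2 * C y * C z + C y ^ 2) * X ^ 2 + (2 * C z + 2 * C y) * X ^ 3 + (2 * C z + 2 * C y + 2 * C y * C z - 3 * C y * C z ^ 2 - 3 * C y ^ 2 * C z) * X ^ 4 + (14 * C y * C z - 8 * C y * C z ^ 2 - 8 * C y ^ 2 * C z) * X ^ 5 + (2 * C y * C z - 3 * C y * C z ^ 2 - 2 * C y * C z ^ 3 - 3 * C y ^ 2 * C z + 4 * C y ^ 2 * C z ^ 2 - 2 * C y ^ 3 * C z) * X ^ 6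 + (2 * C y * C z - 4 * C y * C z ^ 2 - 4 * C y ^ 2 * C z) * X ^ 7 + (4 * C y * C z ^ 2 + 4 * C y ^ 2 * C z - 6 * C y ^ 2 * C z ^ 2 + 3 * C y ^ 2 * C z ^ 3 + 3 * C y ^ 3 * C z ^ 2) * X ^ 8 + (-2 * C y ^ 2 * C z ^ 2 + 4 * C y ^ 2 * C z ^ 3 + 4 * C y ^ 3 * C z ^ 2) * X ^ 9 + (-4 * C y ^ 2 * C z ^ 2 - 4 * C y ^ 2 * C z ^ 3 + C y ^ 2 * C z ^ 4 - 4 * C y ^ 3 * C z ^ 2 - 2 * C y ^ 3 * C z ^ 3 + C y ^ 4 * C z ^ 2) * X ^ 10 + (-2 * C y ^ 2 * C z ^ 3 - 2 * C y ^ 3 * C z ^ 2) * X ^ 11 + (2 * C y ^ 2 * C z ^ 3 + 2 * C y ^ 3 * C z ^ 2 + 6 * C y ^ 3 * C z ^ 3 - (C y ^ 3 * C z ^ 4) - (C y ^ 4 * C z ^ 3)) * X ^ 12 + (-2 * C y ^ 3 * C z ^ 3) * X ^ 13 + (-2 * C y ^ 3 * C z ^ 3 + C y ^ 3 * C z ^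 4 + C y ^ 4 * C z ^ 3) * X ^ 14 + (2 * C y ^ 3 * C z ^ 3) * X ^ 15)

/-- ★★★ **The two-fugacity walk series of the one-cell honeycomb strip is rational:**
`(Σ_N twoWallZ y z N · X^N) · [(1 − yX²)(1 − zX²) − yzX⁶] · (1 − yzX⁴)² = P(X; y, z)` for every real `y, z`
(identified with BBdGDCG's `Σ_N C_{1,N}(y,z) x^N`, `C_{1,N} = HexBW.stripZ₂ 1 N`, in the sequel section).
[cite: BeatonBousquetMelouDeGierDuminilCopinGuttmann2014, §3.2 (arXiv v5 p. 12: the strip series are rational); Stanley2012EC1, §4.7 (Theorem 4.7.2); AlmJanson1990] -/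
theorem twoWallZ_series :
    PowerSeries.mk (twoWallZ y z) * (((1 - C y * X ^ 2) * (1 - C z * X ^ 2) - C y * C z * X ^ 6) * (1 - C y * C z * X ^ 4) ^ 2) =
      twoWallP y z := by
  have hmk : PowerSeries.mk (twoWallZ y z) =
      Ψ y z false start false + Ψ y z false start true + C y * Ψ y z true start false + C z * Ψ y z true start true := by
    ext N
    simp only [twoWallZ, coeff_mk, map_add, PowerSeries.coeff_C_mul, coeff_Ψ_eq_W₂]
  rw [hmk]
  simp only [Ψ, pol, polStart, cond_true, cond_false, qY, twoWallP]
  linear_combination (((2 + C z + C y) + (2 + 4 * C z + 4 * C y) * X + (4 * C z + C z ^ 2 + 4 * C y - 2 * C y * C z + C y ^ 2) * X ^ 2 + (2 * C z + 2 * C y) * X ^ 3 + (2 * C z + 2 * C y + 2 * C y * C z - 3 * C y * C z ^ 2 - 3 * C y ^ 2 * C z) * X ^ 4 + (14 * C y * C z - 8 * C y * C z ^ 2 - 8 * C y ^ 2 * C z) * X ^ 5 + (2 * C y * C z - 3 * C y * C z ^ 2 - 2 * C y * C z ^ 3 - 3 * C y ^ 2 * C z + 4 * C y ^ 2 * C z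 ^ 2 - 2 * C y ^ 3 * C z) * X ^ 6 + (2 * C y * C z - 4 * C y * C z ^ 2 - 4 * C y ^ 2 * C z) * X ^ 7 + (4 * C y * C z ^ 2 + 4 * C y ^ 2 * C z - 6 * C y ^ 2 * C z ^ 2 + 3 * C y ^ 2 * C z ^ 3 + 3 * C y ^ 3 * C z ^ 2) * X ^ 8 + (-2 * C y ^ 2 * C z ^ 2 + 4 * C y ^ 2 * C z ^ 3 + 4 * C y ^ 3 * C z ^ 2) * X ^ 9 + (-4 * C y ^ 2 * C z ^ 2 - 4 * C y ^ 2 * C z ^ 3 + C y ^ 2 * C z ^ 4 - 4 * C y ^ 3 * C z ^ 2 - 2 * C y ^ 3 * C z ^ 3 + C y ^ 4 * C z ^ 2) * X ^ 10 + (-2 * C y ^ 2 * C z ^ 3 - 2 * C y ^ 3 * C z ^ 2) * X ^ 11 + (2 * C y ^ 2 * C z ^ 3 + 2 * C y ^ 3 * C z ^ 2 + 6 * C y ^ 3 * C z ^ 3 - (C y ^ 3 * C z ^ 4) - (C y ^ 4 * C z ^ 3)) * X ^ 12 + (-2 * C y ^ 3 * C z ^ 3) * X ^ 13 + (-2 *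 C y ^ 3 * C z ^ 3 + C y ^ 3 * C z ^ 4 + C y ^ 4 * C z ^ 3) * X ^ 14 + (2 * C y ^ 3 * C z ^ 3) * X ^ 15)) * huD y z

end automaton


/-! ## §6 The weighted automaton counts the walks: `stripZ₂ 1 N y z = twoWallZ y z N`

The geometric half is inherited from `HexSAWBrickWallStripWidthOneSeries.lean`: its automaton `WidthOne.δ` on step words
accepts exactly the step words of the self-avoiding walks of `S_1` (`WidthOne.good_iff_isSome`).  Here we run the SAME
automaton and only add the bookkeeping of site weights: the structural state `enc g x` of a geometric state `g` at column `x`,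
the column-parity compatibility `CPar`, and the weighted sum over accepted words. -/

section glue

open WidthOne

variable (y z : ℝ)

/-- Parity of an integer column as a Boolean (`true` = odd). [folklore] -/
def par (x : ℤ) : Bool := decide (x % 2 = 1)

/-- `par (x + 1) = ¬ par x`. [folklore] -/
private theorem par_add_one (x : ℤ) : par (x + 1) = !par x := by
  unfold par; by_cases h : x % 2 = 1 <;> simp [h] <;> omega

/-- `par (x − 1) = ¬ par x`. [folklore] -/
private theorem par_add_neg_one (x : ℤ) : par (x + -1) = !par x := by
  unfold par; by_cases h : x % 2 = 1 <;> simp [h] <;> omega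

/-- The weight of a site of the strip: `y` / `z` at an odd column of the bottom / top row, else `1`.
[cite: BeatonBousquetMelouDeGierDuminilCopinGuttmann2014, §3.2 (arXiv v5 p. 10: y^{bc(ω)} z^{tc(ω)})] -/
def swt (v : Site 2) : ℝ := bif par (v 0) then wρ y z (decide (v 1 = 1)) else 1

/-- The weight of a word placed at `a`: the product of the weights of the sites it visits AFTER `a`.
[cite: BeatonBousquetMelouDeGierDuminilCopinGuttmann2014, §3.2 (arXiv v5 p. 10)] -/
def wprod : Site 2 → List Step → ℝ
  | _, [] => 1
  | a, ℓ :: w => swt y z (a + Step.vec ℓ) * wprod (a + Step.vec ℓ) w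

/-- The structural (weighted-automaton) state of a geometric state `g` at column `x`. [cite: Stanley2012EC1, §4.7] -/
def enc (g : GState) (x : ℤ) : S2 :=
  match g.s with
  | .start => start
  | .ini k => if k % 2 = 0 then iniE (k / 2) else iniO (k / 2)
  | .rg1 0 => rg1Z
  | .rg1 (j + 1) => if j % 2 = 0 then rg1O (j / 2) else rg1E (j / 2)
  | .ut i => if i % 2 = 0 then utE (i / 2) else utO (i / 2)
  | .up k => if k % 2 = 0 then upE (k / 2) else upO (k / 2)
  | .fwd k => if k % 2 = 0 then fwdE (k / 2) else fwdO (k / 2)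
  | .rg2 k => if k % 2 = 0 then rg2E (k / 2) else rg2O (k / 2)
  | .cor j => if j % 2 = 0 then corE (j / 2) (par x) else corO (j / 2) (par x)

/-- Column-parity compatibility of a geometric state at column `x` (start-column parity `p`): the parity the weighted automaton
assumes is the actual one. [cite: Stanley2012EC1, §4.7] -/
def CPar (p : Bool) (g : GState) (x : ℤ) : Prop :=
  match g.s with
  | .start => par x = p
  | .ini k => par x = xor p (decide (k % 2 = 0))
  | .rg1 a => par x = false ∧ decide (a % 2 = 1) = p
  | .ut i => par x = xor p (decide (i % 2 = 1))
  | .up k => par x = xor p (decide (k % 2 = 0))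
  | .fwd k => par x = decide (k % 2 = 0)
  | .rg2 _ => par x = false
  | .cor _ => True

/-- Full compatibility of a geometric state with a current site `a`. [cite: Stanley2012EC1, §4.7] -/
def Compat (p : Bool) (g : GState) (a : Site 2) : Prop :=
  HOk g ∧ (g.r = 0 ∨ g.r = 1) ∧ a 1 = g.r ∧ CPar p g (a 0)

/-- Arithmetic of the structural indices. [folklore] -/
private theorem idx_facts (i : ℕ) :
    (2 * i) % 2 = 0 ∧ (2 * i) / 2 = i ∧ (2 * i + 1) % 2 = 1 ∧ (2 * i + 1) / 2 = i ∧ (2 * i + 2) % 2 = 0 ∧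
      (2 * i + 2) / 2 = i + 1 ∧ (2 * i + 1 + 1) % 2 = 0 ∧ (2 * i + 1 + 1) / 2 = i + 1 ∧
      (2 * i + 3) % 2 = 1 ∧ (2 * i + 3) / 2 = i + 1 := by omega

/-- `Option.elim` through an `if`. [folklore] -/
private theorem elimIte {α β : Type*} (c : Prop) [Decidable c] (x : α) (b : β) (f : α → β) :
    (if c then some x else none).elim b f = if c then f x else b := by
  split_ifs <;> rfl

/-- `2(n+1) = (2n+1)+1` (to expose the successor pattern). [folklore] -/
private theorem twoMulSucc (n : ℕ) : 2 * (n + 1) = 2 * n + 1 + 1 := by ring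

/-- Conclusion of the weighted one-letter analysis at `g`, `a`: every successor is compatible (one clause per letter), and the
letter sum of `weight × W₂(successor)` is the weighted automaton's `stepR` at the encoded state. [cite: Stanley2012EC1, §4.7] -/
def GlueConcl (p : ℕ) (pb : Bool) (m : ℕ) (g : GState) (a : Site 2) : Prop :=
  ((δ p g 0).elim True fun g' => Compat pb g' (a + Step.vec 0)) ∧
  ((δ p g 1).elim True fun g' => Compat pb g' (a + Step.vec 1)) ∧
  ((δ p g 2).elim True fun g' => Compat pb g' (a + Step.vec 2)) ∧
  ((δ p g 3).elim True fun g' => Compat pb g' (a + Step.vec 3)) ∧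
    ∑ ℓ : Step, ((δ p g ℓ).elim 0 fun g' =>
        swt y z (a + Step.vec ℓ) * W₂ y z pb (enc g' ((a + Step.vec ℓ) 0)) (decide ((a + Step.vec ℓ) 1 = 1)) m) =
      stepR y z pb (fun t ρ => W₂ y z pb t ρ m) (enc g (a 0)) (decide (a 1 = 1))

set_option maxHeartbeats 400000 in
/-- Weighted one-letter analysis at `LState.start`. [cite: Stanley2012EC1, §4.7] -/
theorem glue_start {p : ℕ} {pb : Bool} (hp : (p = 0 ∧ pb = false) ∨ (p = 1 ∧ pb = true)) (m : ℕ) (h r : ℤ) (a : Site 2)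
    (hc : Compat pb ⟨LState.start, h, r⟩ a) : GlueConcl y z p pb m ⟨LState.start, h, r⟩ a := by
  obtain ⟨hok, hr, ha1, hcp⟩ := hc
  simp only [HOk] at hok; simp only [CPar] at hcp; simp only at hr ha1
  have I := idx_facts
  rcases hp with ⟨rfl, rfl⟩ | ⟨rfl, rfl⟩ <;> rcases hr with rfl | rfl <;> subst hok <;>
    simp [GlueConcl, Compat, CPar, HOk, δ, fwdT, rungT, Fin.sum_univ_four, Step.dx, Step.dy, Step.vec, enc, stepR, swt, wρ, par_add_one, par_add_neg_one, elimIte, Nat.even_add_one, ha1, hcp]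
  all_goals ring

set_option maxHeartbeats 400000 in
/-- Weighted one-letter analysis at `LState.ini k`. [cite: Stanley2012EC1, §4.7] -/
theorem glue_ini {p : ℕ} {pb : Bool} (hp : (p = 0 ∧ pb = false) ∨ (p = 1 ∧ pb = true)) (m : ℕ) (k : ℕ) (h r : ℤ) (a : Site 2)
    (hc : Compat pb ⟨LState.ini k, h, r⟩ a) : GlueConcl y z p pb m ⟨LState.ini k, h, r⟩ a := by
  obtain ⟨hok, hr, ha1, hcp⟩ := hc
  simp only [HOk] at hok; simp only [CPar] at hcp; simp only at hr ha1
  have I := idx_facts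
  rcases hp with ⟨rfl, rfl⟩ | ⟨rfl, rfl⟩ <;> rcases hr with rfl | rfl <;> rcases hok with rfl | rfl <;>
    obtain ⟨k', rfl | rfl⟩ := Nat.even_or_odd' k <;>
    (try simp [I] at hcp) <;>
    simp [GlueConcl, Compat, CPar, HOk, δ, fwdT, backT, rungT, Fin.sum_univ_four, Step.dx, Step.dy, Step.vec, enc, stepR, swt, wρ, par_add_one, par_add_neg_one, I, Nat.even_add, Nat.even_add_one, ha1, hcp] <;> ring

set_option maxHeartbeats 400000 in
/-- Weighted one-letter analysis at `LState.rg1 0`. [cite: Stanley2012EC1, §4.7] -/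
theorem glue_rg1z {p : ℕ} {pb : Bool} (hp : (p = 0 ∧ pb = false) ∨ (p = 1 ∧ pb = true)) (m : ℕ) (h r : ℤ) (a : Site 2)
    (hc : Compat pb ⟨LState.rg1 0, h, r⟩ a) : GlueConcl y z p pb m ⟨LState.rg1 0, h, r⟩ a := by
  obtain ⟨hok, hr, ha1, hcp⟩ := hc
  simp only [HOk] at hok; simp only [CPar] at hcp; simp only at hr ha1
  have I := idx_facts
  rcases hp with ⟨rfl, rfl⟩ | ⟨rfl, rfl⟩ <;> rcases hr with rfl | rfl <;> subst hok <;>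
    (try simp [] at hcp) <;>
    simp [GlueConcl, Compat, CPar, HOk, δ, fwdT, rungT, Fin.sum_univ_four, Step.dx, Step.dy, Step.vec, enc, stepR, swt, wρ, par_add_one, par_add_neg_one, elimIte, ha1, hcp]

set_option maxHeartbeats 400000 in
/-- Weighted one-letter analysis at `LState.rg1 (j + 1)`. [cite: Stanley2012EC1, §4.7] -/
theorem glue_rg1s {p : ℕ} {pb : Bool} (hp : (p = 0 ∧ pb = false) ∨ (p = 1 ∧ pb = true)) (m : ℕ) (j : ℕ) (h r : ℤ) (a : Site 2)
    (hc : Compat pb ⟨LState.rg1 (j + 1), h, r⟩ a) : GlueConcl y z p pb m ⟨LState.rg1 (j + 1), h, r⟩ a := by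
  obtain ⟨hok, hr, ha1, hcp⟩ := hc
  simp only [HOk] at hok; simp only [CPar] at hcp; simp only at hr ha1
  have I := idx_facts
  rcases hp with ⟨rfl, rfl⟩ | ⟨rfl, rfl⟩ <;> rcases hr with rfl | rfl <;> rcases hok with rfl | rfl <;>
    obtain ⟨j', rfl | rfl⟩ := Nat.even_or_odd' j <;>
    (try simp [I] at hcp) <;>
    simp [GlueConcl, Compat, CPar, HOk, δ, fwdT, backT, rungT, Fin.sum_univ_four, Step.dx, Step.dy, Step.vec, enc, stepR, swt, wρ, par_add_one, par_add_neg_one, I, ha1, hcp] <;> ring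

set_option maxHeartbeats 400000 in
/-- Weighted one-letter analysis at `LState.ut i`. [cite: Stanley2012EC1, §4.7] -/
theorem glue_ut {p : ℕ} {pb : Bool} (hp : (p = 0 ∧ pb = false) ∨ (p = 1 ∧ pb = true)) (m : ℕ) (i : ℕ) (h r : ℤ) (a : Site 2)
    (hc : Compat pb ⟨LState.ut i, h, r⟩ a) : GlueConcl y z p pb m ⟨LState.ut i, h, r⟩ a := by
  obtain ⟨hok, hr, ha1, hcp⟩ := hc
  simp only [HOk] at hok; simp only [CPar] at hcp; simp only at hr ha1
  have I := idx_facts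
  rcases hp with ⟨rfl, rfl⟩ | ⟨rfl, rfl⟩ <;> rcases hr with rfl | rfl <;> rcases hok with rfl | rfl <;>
    obtain ⟨i', rfl | rfl⟩ := Nat.even_or_odd' i <;> rcases i' with _ | i' <;>
    (try simp [I] at hcp) <;>
    simp [GlueConcl, Compat, CPar, HOk, δ, fwdT, backT, rungT, Fin.sum_univ_four, Step.dx, Step.dy, Step.vec, enc, stepR, swt, wρ, par_add_one, par_add_neg_one, I, twoMulSucc, ha1, hcp]

set_option maxHeartbeats 400000 in
/-- Weighted one-letter analysis at `LState.up k`. [cite: Stanley2012EC1, §4.7] -/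
theorem glue_up {p : ℕ} {pb : Bool} (hp : (p = 0 ∧ pb = false) ∨ (p = 1 ∧ pb = true)) (m : ℕ) (k : ℕ) (h r : ℤ) (a : Site 2)
    (hc : Compat pb ⟨LState.up k, h, r⟩ a) : GlueConcl y z p pb m ⟨LState.up k, h, r⟩ a := by
  obtain ⟨hok, hr, ha1, hcp⟩ := hc
  simp only [HOk] at hok; simp only [CPar] at hcp; simp only at hr ha1
  have I := idx_facts
  rcases hp with ⟨rfl, rfl⟩ | ⟨rfl, rfl⟩ <;> rcases hr with rfl | rfl <;> rcases hok with rfl | rfl <;>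
    obtain ⟨k', rfl | rfl⟩ := Nat.even_or_odd' k <;>
    (try simp [I] at hcp) <;>
    simp [GlueConcl, Compat, CPar, HOk, δ, fwdT, backT, rungT, Fin.sum_univ_four, Step.dx, Step.dy, Step.vec, enc, stepR, swt, wρ, par_add_one, par_add_neg_one, I, Nat.even_add, Nat.even_add_one, ha1, hcp] <;> ring

set_option maxHeartbeats 400000 in
/-- Weighted one-letter analysis at `LState.fwd k`. [cite: Stanley2012EC1, §4.7] -/
theorem glue_fwd {p : ℕ} {pb : Bool} (hp : (p = 0 ∧ pb = false) ∨ (p = 1 ∧ pb = true)) (m : ℕ) (k : ℕ) (h r : ℤ) (a : Site 2)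
    (hc : Compat pb ⟨LState.fwd k, h, r⟩ a) : GlueConcl y z p pb m ⟨LState.fwd k, h, r⟩ a := by
  obtain ⟨hok, hr, ha1, hcp⟩ := hc
  simp only [HOk] at hok; simp only [CPar] at hcp; simp only at hr ha1
  have I := idx_facts
  rcases hp with ⟨rfl, rfl⟩ | ⟨rfl, rfl⟩ <;> rcases hr with rfl | rfl <;> rcases hok with rfl | rfl <;>
    obtain ⟨k', rfl | rfl⟩ := Nat.even_or_odd' k <;>
    (try simp [I] at hcp) <;>
    simp [GlueConcl, Compat, CPar, HOk, δ, fwdT, backT, rungT, Fin.sum_univ_four, Step.dx, Step.dy, Step.vec, enc, stepR, swt, wρ, par_add_one, par_add_neg_one, I, Nat.even_add_one, ha1, hcp] <;> ring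

set_option maxHeartbeats 400000 in
/-- Weighted one-letter analysis at `LState.rg2 k`. [cite: Stanley2012EC1, §4.7] -/
theorem glue_rg2 {p : ℕ} {pb : Bool} (hp : (p = 0 ∧ pb = false) ∨ (p = 1 ∧ pb = true)) (m : ℕ) (k : ℕ) (h r : ℤ) (a : Site 2)
    (hc : Compat pb ⟨LState.rg2 k, h, r⟩ a) : GlueConcl y z p pb m ⟨LState.rg2 k, h, r⟩ a := by
  obtain ⟨hok, hr, ha1, hcp⟩ := hc
  simp only [HOk] at hok; simp only [CPar] at hcp; simp only at hr ha1
  have I := idx_facts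
  rcases hp with ⟨rfl, rfl⟩ | ⟨rfl, rfl⟩ <;> rcases hr with rfl | rfl <;> rcases hok with rfl | rfl <;>
    obtain ⟨k', rfl | rfl⟩ := Nat.even_or_odd' k <;> rcases k' with _ | k' <;>
    simp [GlueConcl, Compat, CPar, HOk, δ, fwdT, backT, rungT, Fin.sum_univ_four, Step.dx, Step.dy, Step.vec, enc, stepR, swt, wρ, par_add_one, par_add_neg_one, I, twoMulSucc, ha1, hcp] <;> ring

set_option maxHeartbeats 400000 in
/-- Weighted one-letter analysis at `LState.cor j`. [cite: Stanley2012EC1, §4.7] -/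
theorem glue_cor {p : ℕ} {pb : Bool} (hp : (p = 0 ∧ pb = false) ∨ (p = 1 ∧ pb = true)) (m : ℕ) (j : ℕ) (h r : ℤ) (a : Site 2)
    (hc : Compat pb ⟨LState.cor j, h, r⟩ a) : GlueConcl y z p pb m ⟨LState.cor j, h, r⟩ a := by
  obtain ⟨hok, hr, ha1, hcp⟩ := hc
  simp only [HOk] at hok; simp only [CPar] at hcp; simp only at hr ha1
  have I := idx_facts
  rcases hp with ⟨rfl, rfl⟩ | ⟨rfl, rfl⟩ <;> rcases hr with rfl | rfl <;> rcases hok with rfl | rfl <;>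
    obtain ⟨j', rfl | rfl⟩ := Nat.even_or_odd' j <;> rcases j' with _ | j' <;> cases hpa : par (a 0) <;>
    simp [GlueConcl, Compat, CPar, HOk, δ, fwdT, backT, rungT, Fin.sum_univ_four, Step.dx, Step.dy, Step.vec, enc, stepR, swt, wρ, par_add_one, par_add_neg_one, I, twoMulSucc, ha1, hpa]


/-- **The weighted one-letter analysis from any compatible state.** [cite: Stanley2012EC1, §4.7 (transfer-matrix method)] -/
theorem glue_all {p : ℕ} {pb : Bool} (hp : (p = 0 ∧ pb = false) ∨ (p = 1 ∧ pb = true)) (m : ℕ) (g : GState) (a : Site 2)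
    (hc : Compat pb g a) : GlueConcl y z p pb m g a := by
  obtain ⟨s, h, r⟩ := g
  cases s with
  | start => exact glue_start y z hp m h r a hc
  | ini k => exact glue_ini y z hp m k h r a hc
  | rg1 j => cases j with
    | zero => exact glue_rg1z y z hp m h r a hc
    | succ j => exact glue_rg1s y z hp m j h r a hc
  | ut i => exact glue_ut y z hp m i h r a hc
  | up k => exact glue_up y z hp m k h r a hc
  | fwd k => exact glue_fwd y z hp m k h r a hc
  | rg2 k => exact glue_rg2 y z hp m k h r a hc
  | cor j => exact glue_cor y z hp m j h r a hc

/-- Successors of compatible states are compatible. [cite: Stanley2012EC1, §4.7] -/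
theorem compat_step {p : ℕ} {pb : Bool} (hp : (p = 0 ∧ pb = false) ∨ (p = 1 ∧ pb = true)) {g g' : GState} {a : Site 2}
    (hc : Compat pb g a) {ℓ : Step} (hδ : δ p g ℓ = some g') : Compat pb g' (a + Step.vec ℓ) := by
  obtain ⟨h0, h1, h2, h3, -⟩ := glue_all 0 0 hp 0 g a hc
  have key : ∀ ℓ' : Step, (δ p g ℓ').elim True fun g'' => Compat pb g'' (a + Step.vec ℓ') := by
    intro ℓ'
    match ℓ' with
    | ⟨0, _⟩ => exact h0
    | ⟨1, _⟩ => exact h1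
    | ⟨2, _⟩ => exact h2
    | ⟨3, _⟩ => exact h3
    | ⟨n + 4, hn⟩ => exact absurd hn (by omega)
  have := key ℓ
  rw [hδ] at this
  exact this

/-- The weighted sum over the accepted words of length `m` from `g` at the site `a`. [cite: Stanley2012EC1, §4.7] -/
def accZ (p : ℕ) (g : GState) (a : Site 2) (m : ℕ) : ℝ := ∑ w ∈ acc p g m, wprod y z a w

/-- One letter at a time, weighted. [cite: Stanley2012EC1, §4.7] -/
theorem accZ_succ (p : ℕ) (g : GState) (a : Site 2) (m : ℕ) :
    accZ y z p g a (m + 1) = ∑ ℓ : Step, ((δ p g ℓ).elim 0 fun g' => swt y z (a + Step.vec ℓ) * accZ y z p g' (a + Step.vec ℓ) m) := by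
  classical
  have hinj : Function.Injective (fun q : Step × List Step => q.1 :: q.2) := by
    rintro ⟨a, b⟩ ⟨c, d⟩ h; simpa using h
  rw [accZ, acc, words_succ, Finset.filter_image, Finset.sum_image (fun x _ y _ h => hinj h), Finset.sum_filter,
    Finset.sum_product]
  refine Finset.sum_congr rfl fun ℓ _ => ?_
  simp_rw [run_cons]
  cases hδ : δ p g ℓ with
  | none => simp
  | some g' =>
    simp only [Option.elim, Option.bind_some, wprod]
    rw [accZ, acc, Finset.sum_filter, Finset.mul_sum]
    exact Finset.sum_congr rfl fun w _ => by split_ifs <;> simp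

/-- ★★ **The weighted automaton computes the weighted word sums**: from a compatible state,
`Σ_{w accepted, |w| = m} wprod a w = W₂ p (enc g (a 0)) (row) m`. [cite: Stanley2012EC1, §4.7 (Theorem 4.7.2)] -/
theorem accZ_eq {p : ℕ} {pb : Bool} (hp : (p = 0 ∧ pb = false) ∨ (p = 1 ∧ pb = true)) (m : ℕ) (g : GState) (a : Site 2)
    (hc : Compat pb g a) : accZ y z p g a m = W₂ y z pb (enc g (a 0)) (decide (a 1 = 1)) m := by
  induction m generalizing g a with
  | zero =>
    rw [W₂_zero, accZ]
    have : acc p g 0 = {[]} := by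
      ext w; simp only [acc, Finset.mem_filter, mem_words, List.length_eq_zero_iff, Finset.mem_singleton]
      exact ⟨fun h => h.1, fun h => by subst h; exact ⟨rfl, by simp⟩⟩
    rw [this, Finset.sum_singleton]; rfl
  | succ m ih =>
    rw [accZ_succ, W₂_succ, ← (glue_all y z hp m g a hc).2.2.2.2]
    refine Finset.sum_congr rfl fun ℓ _ => ?_
    cases hδ : δ p g ℓ with
    | none => rfl
    | some g' => simp only [Option.elim]; rw [ih g' _ (compat_step hp hc hδ)]

/-! ### Word weights versus the printed visit counts -/

/-- For a site of the strip, `y^{[bottom contact]} · z^{[top contact]} = swt`. [cite: BeatonBousquetMelouDeGierDuminilCopinGuttmann2014, §3.2 (arXiv v5 p. 10)] -/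
theorem pow_ind_eq_swt (v : Site 2) (hv : v 1 = 0 ∨ v 1 = 1) :
    y ^ (if v 1 = 0 ∧ v 0 % 2 = 1 then 1 else 0) * z ^ (if v 1 = (1 : ℕ) ∧ (v 0 + 1) % 2 = 0 then 1 else 0) = swt y z v := by
  unfold swt par wρ
  rcases hv with h | h <;> by_cases hx : v 0 % 2 = 1 <;> simp [h, hx] <;> omega

/-- **Weights = visit counts**: for a placed vertex function with rows in `{0,1}`,
`y^{bottomVisits₀} z^{topVisits₀} = Π_m swt (a + ω m)`. [cite: BeatonBousquetMelouDeGierDuminilCopinGuttmann2014, §3.2 (arXiv v5 p. 10)] -/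
theorem pow_visits_eq_prod (a : Site 2) (ω : ℕ → Site 2) (N : ℕ) (hrow : ∀ m ≤ N, (a + ω m) 1 = 0 ∨ (a + ω m) 1 = 1) :
    y ^ bottomVisits₀ a ω N * z ^ topVisits₀ 1 a ω N = ∏ m ∈ Finset.range (N + 1), swt y z (a + ω m) := by
  rw [bottomVisits₀, topVisits₀, ← Finset.prod_pow_eq_pow_sum, ← Finset.prod_pow_eq_pow_sum, ← Finset.prod_mul_distrib]
  exact Finset.prod_congr rfl fun m hm => pow_ind_eq_swt y z _ (hrow m (by simpa [Nat.lt_succ_iff] using hm))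

/-- `traj (ℓ :: w) (i+1) = vec ℓ + traj w i`. [folklore] -/
private theorem traj_cons_succ' (ℓ : Step) (w : List Step) (i : ℕ) : traj (ℓ :: w) (i + 1) = Step.vec ℓ + traj w i := by
  simp [traj, List.take_succ_cons]

/-- The product of the site weights along a word is `swt a · wprod a w`. [cite: BeatonBousquetMelouDeGierDuminilCopinGuttmann2014, §3.2 (arXiv v5 p. 10)] -/
theorem prod_swt_traj (a : Site 2) (w : List Step) :
    ∏ m ∈ Finset.range (w.length + 1), swt y z (a + traj w m) = swt y z a * wprod y z a w := by
  induction w generalizing a with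
  | nil => simp [wprod]
  | cons ℓ w ih =>
    rw [Finset.prod_range_succ', wprod, List.length_cons]
    simp only [traj_cons_succ', ← add_assoc, traj_zero, add_zero]
    rw [ih (a + Step.vec ℓ)]; ring

/-! ### Assembly -/

/-- The weighted fibre over a starting site. [cite: MadrasSlade1993, §8.2, eq. (8.2.1)] -/
theorem sum_filter_stripPairs (N : ℕ) {a : Site 2} (ha : a ∈ stripStarts 1) :
    ∑ q ∈ (stripPairs 1 N).filter (fun q => q.1 = a), y ^ bottomVisits₀ q.1 q.2 N * z ^ topVisits₀ 1 q.1 q.2 N =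
      swt y z a * W₂ y z (par (a 0)) start (decide (a 1 = 1)) N := by
  classical
  obtain ⟨⟨ha0, ha0'⟩, ha1, ha1'⟩ := mem_stripStarts.1 ha
  rw [filter_stripPairs_eq N ha, Finset.sum_image]
  swap
  · intro w hw w' hw' h
    simp only [Finset.mem_coe, acc, Finset.mem_filter, mem_words] at hw hw'
    simp only [Prod.mk.injEq, true_and] at h
    exact eq_of_traj_eq (hw.1.trans hw'.1.symm) h
  have hp : ((a 0).toNat = 0 ∧ par (a 0) = false) ∨ ((a 0).toNat = 1 ∧ par (a 0) = true) := by
    rcases (show a 0 = 0 ∨ a 0 = 1 by omega) with h | h <;> simp [h, par]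
  have hc : Compat (par (a 0)) (startG a) a := by
    refine ⟨by simp [HOk, startG], by simp only [startG]; push_cast at ha1'; omega, rfl, ?_⟩
    simp [CPar, startG]
  rw [show start = enc (startG a) (a 0) from rfl, ← accZ_eq y z hp N (startG a) a hc, accZ, Finset.mul_sum]
  refine Finset.sum_congr rfl fun w hw => ?_
  simp only [acc, Finset.mem_filter, mem_words] at hw
  have hgood : Good a w := (good_iff_isSome (p := (a 0).toNat) (Int.toNat_of_nonneg ha0).symm
    (by push_cast at ha1'; omega) w).2 hw.2
  rw [← hw.1, pow_visits_eq_prod, prod_swt_traj]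
  intro m hm
  have := hgood.2.2 m hm
  simp only [InStrip, Nat.cast_one] at this
  show (a + traj w m) 1 = 0 ∨ (a + traj w m) 1 = 1
  omega

/-- ★★★ **The weighted automaton counts the printed partition function: `C_{1,N}(y,z) = stripZ₂ 1 N y z = twoWallZ y z N`.**
[cite: BeatonBousquetMelouDeGierDuminilCopinGuttmann2014, §3.2 (arXiv v5 p. 10: C_{T,k}(y,z)); Stanley2012EC1, §4.7 (Theorem 4.7.2)] -/
theorem stripZ₂_one_eq_twoWallZ (N : ℕ) : stripZ₂ 1 N y z = twoWallZ y z N := by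
  classical
  rw [stripZ₂, ← Finset.sum_fiberwise_of_maps_to (g := Prod.fst) (t := stripStarts 1)
    (fun q hq => (mem_stripPairs.1 hq).1)]
  rw [Finset.sum_congr rfl fun a ha => sum_filter_stripPairs y z N ha, stripStarts_one]
  rw [Finset.sum_insert (by decide), Finset.sum_insert (by decide), Finset.sum_insert (by decide), Finset.sum_singleton]
  simp [swt, par, wρ, twoWallZ]
  ring

/-- ★★★ **THE TWO-FUGACITY WALK SERIES OF THE ONE-CELL HONEYCOMB STRIP**: for all real `y, z`,
`(Σ_N C_{1,N}(y,z) X^N) · [(1 − yX²)(1 − zX²) − yzX⁶] · (1 − yzX⁴)² = P(X; y, z)` with `C_{1,N}(y,z) = HexBW.stripZ₂ 1 N y z`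
(BBdGDCG's partition function of the strip `S_1` with both walls attracting) and the explicit `P = twoWallP`; the dominant
singularity is the root of the sextic `s(s−y)(s−z) = yz`, `s = μ_1(y,z)²` (tree: `…WidthOneExact`, `…WidthOneSexticLower`).
[cite: BeatonBousquetMelouDeGierDuminilCopinGuttmann2014, §3.2 (arXiv v5 p. 12: the strip series are rational); Stanley2012EC1, §4.7 (Theorem 4.7.2); AlmJanson1990] -/
theorem stripZ₂_one_series :
    PowerSeries.mk (fun N => stripZ₂ 1 N y z) *
        (((1 - C y * X ^ 2) * (1 - C z * X ^ 2) - C y * C z * X ^ 6) * (1 - C y * C z * X ^ 4) ^ 2) = twoWallP y z := by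
  rw [show (PowerSeries.mk fun N => stripZ₂ 1 N y z) = PowerSeries.mk (twoWallZ y z) from by
    ext N; rw [coeff_mk, coeff_mk, stripZ₂_one_eq_twoWallZ]]
  exact twoWallZ_series y z



/-- ★★ **The one-wall specialisation** (`z = 1`): `(Σ_N C_{1,N}(y,1) X^N) · [(1 − yX²)(1 − X²) − yX⁶] · (1 − yX⁴)² = P(X; y, 1)`,
`C_{1,N}(y,1) = HexBW.stripZ₀ 1 N y` (BBdGDCG's printed one-wall strip partition function, Proposition 7's `C_{T,n}(y,1)` at `T = 1`).
[cite: BeatonBousquetMelouDeGierDuminilCopinGuttmann2014, Proposition 7 (arXiv v5 p. 11: μ_T(y,1)); Stanley2012EC1, §4.7 (Theorem 4.7.2)] -/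
theorem stripZ₀_one_series :
    PowerSeries.mk (fun N => stripZ₀ 1 N y) *
        (((1 - C y * X ^ 2) * (1 - X ^ 2) - C y * X ^ 6) * (1 - C y * X ^ 4) ^ 2) = twoWallP y 1 := by
  have h := stripZ₂_one_series y 1
  simp only [stripZ₂_one_right, map_one, one_mul, mul_one] at h
  exact h

/-- ★★ **The equal-walls specialisation** (`z = y`, the setting of `HexSAWBrickWallStripFugacityWidthOneExact.lean`):
`(Σ_N C_{1,N}(y,y) X^N) · [(1 − yX²)² − y²X⁶] · (1 − y²X⁴)² = P(X; y, y)`, where `(1 − yX²)² − y²X⁶ = (1 − yX² − yX³)(1 − yX² + yX³)`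
— at `y = 1` the printed `1 − 2x² + x⁴ − x⁶` of Beaton–Guttmann–Jensen.
[cite: BeatonBousquetMelouDeGierDuminilCopinGuttmann2014, Proposition 6 (arXiv v5 p. 10: μ_T(y,z)); Stanley2012EC1, §4.7 (Theorem 4.7.2)] -/
theorem stripZ₂_one_self_series :
    PowerSeries.mk (fun N => stripZ₂ 1 N y y) *
        ((1 - C y * X ^ 2 - C y * X ^ 3) * (1 - C y * X ^ 2 + C y * X ^ 3) * (1 - C y * C y * X ^ 4) ^ 2) =
      twoWallP y y := by
  rw [← stripZ₂_one_series y y]; ring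

end glue

end WidthOneYZ

end Literature.Probability.RandomPlanarGeometry.SAW.HexBW
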